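import Literature.AlgebraicGeometry.HodgeTheory.RibetTypeEightyThreefoldPowersHodgeClasses
import Literature.AlgebraicGeometry.Motives.HodgeThetaSubalgebraUnitaryEightSeventyFiveCore
import Literature.AlgebraicGeometry.Motives.HodgeThetaSubalgebraUnitaryNineSeventyFourCore
import Literature.AlgebraicGeometry.Motives.HodgeThetaSubalgebraUnitaryFourteenSixtyNineCore
import Literature.AlgebraicGeometry.Motives.HodgeThetaSubalgebraUnitaryFifteenSixtyEightCore
import Literature.AlgebraicGeometry.Motives.HodgeThetaSubalgebraUnitarySeventeenSixtySixCore
import Literature.AlgebraicGeometry.Motives.HodgeThetaSubalgebraUnitaryEighteenSixtyFiveCore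
import Literature.AlgebraicGeometry.Motives.HodgeThetaSubalgebraUnitaryNineteenSixtyFourCore
import Literature.AlgebraicGeometry.Motives.HodgeThetaSubalgebraUnitaryTwentySixtyThreeCore
import Literature.AlgebraicGeometry.Motives.HodgeThetaSubalgebraUnitaryTwentyOneSixtyTwoCore
import Literature.AlgebraicGeometry.Motives.HodgeThetaSubalgebraUnitaryTwentyThreeSixtyCore
import Literature.AlgebraicGeometry.Motives.HodgeThetaSubalgebraUnitaryTwentyFiveFiftyEightCore
import Literature.AlgebraicGeometry.Motives.HodgeThetaSubalgebraUnitaryTwentySixFiftySevenCore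
import Literature.AlgebraicGeometry.Motives.HodgeThetaSubalgebraUnitaryTwentySevenFiftySixCore
import Literature.AlgebraicGeometry.Motives.HodgeThetaSubalgebraUnitaryTwentyEightFiftyFiveCore
import Literature.AlgebraicGeometry.Motives.HodgeThetaSubalgebraUnitaryTwentyNineFiftyFourCore
import Literature.AlgebraicGeometry.Motives.HodgeThetaSubalgebraUnitaryThirtyOneFiftyTwoCore
import Literature.AlgebraicGeometry.Motives.HodgeThetaSubalgebraUnitaryThirtyTwoFiftyOneCore
import Literature.AlgebraicGeometry.Motives.HodgeThetaSubalgebraUnitaryThirtyThreeFiftyCore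
import Literature.AlgebraicGeometry.Motives.HodgeThetaSubalgebraUnitaryThirtyFourFortyNineCore
import Literature.AlgebraicGeometry.Motives.HodgeThetaSubalgebraUnitaryThirtyFiveFortyEightCore
import Literature.AlgebraicGeometry.Motives.HodgeThetaSubalgebraUnitaryThirtySevenFortySixCore
import Literature.AlgebraicGeometry.Motives.HodgeThetaSubalgebraUnitaryThirtyEightFortyFiveCore
import Literature.AlgebraicGeometry.Motives.HodgeThetaSubalgebraUnitaryThirtyNineFortyFourCore
import Literature.AlgebraicGeometry.Motives.HodgeThetaSubalgebraUnitaryFortyOneFortyTwoCore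
import HarnessLib

/-!
# Hodge classes on all powers of abelian varieties of Ribet type `(8, 75)`, `(9, 74)`, `(14, 69)`, `(15, 68)`, `(17, 66)`, `(18, 65)`, `(19, 64)`, `(20, 63)`, `(21, 62)`, `(23, 60)`, `(25, 58)`, `(26, 57)`, `(27, 56)`, `(28, 55)`, `(29, 54)`, `(31, 52)`, `(32, 51)`, `(33, 50)`, `(34, 49)`, `(35, 48)`, `(37, 46)`, `(38, 45)`, `(39, 44)`, `(41, 42)`
# are generated by divisor classes (Ribet 1983 Thm. 3 at these multiplicities, by the MINIMAL-RANK method —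
# UNCONDITIONAL); EVERY SIMPLE COMPLEX ABELIAN 83-FOLD WITH `End⁰ ≠ ℚ`

Family `hodge`, layer `Literature/AlgebraicGeometry/HodgeTheory`. Research context: cell `pub-hodge-ring2` (HONEST
FRAMING: research route conditional on HC_CM; not a corollary; Q11.4-sentence-2 already refuted in dim ≥ 3),
Literature lane gen 89. UNCONDITIONAL for the class of abelian varieties it names; theorems only, no definition, no
named fact (D-0026), no `sorry`. The CELLS of the generic assembly `RibetTypeOfCoreSmulPowersHodgeClasses` at the
minimal-rank cores `Unitary….eq_top_of_smul` of the eleven `p = 83` cells with bad raising ranks (settled rank by rank: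
a full small Levi algebra and lifts killed in the large one, two pencils, exclusive Levi profiles, TOOL C, the
orthogonal-chain count `UnitaryOrthogonalChain.false_of_constProfile(_pos)`, constant-rank sub-Levi lemmas, the mirror
`−Θ` and raising-rank sub-families), and the conclusion of the census `isDivisorGenerated_powSucc_of_isSimple_eightythreefold`:
with all eleven residual `k`-signatures `{8, 75}`, `{9, 74}`, `{14, 69}`, `{15, 68}`, `{17, 66}`, `{18, 65}`, `{19, 64}`, `{20, 63}`, `{21, 62}`, `{23, 60}`, `{25, 58}`, `{26, 57}`, `{27, 56}`, `{28, 55}`, `{29, 54}`, `{31, 52}`, `{32, 51}`, `{33, 50}`, `{34, 49}`, `{35, 48}`, `{37, 46}`, `{38, 45}`, `{39, 44}`, `{41, 42}` supplied, every simple complex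
abelian `83`-fold with `End⁰ ≠ ℚ` has `B• = D•` and the Hodge conjecture on all powers — `p = 83` COMPLETE, as
`p = 17, …, 43` before it (`RibetTypeTwentyOneTwentyTwoPowersHodgeClasses`).

THE PRINTED THEOREM. Ribet, Amer. J. Math. 105 (1983), Thm. 3 = Gordon's survey Thm. 6.3 (3) [held
`paper:arxiv-alg-geom_9709030` p. 18]: for an abelian variety `A` with `End⁰(A)` an imaginary quadratic field `K` acting
with relatively prime multiplicities `(n′, n″)`, `Hg(A) = Lf(A)` and the Hodge ring of every power of `A` is generated by
divisors (ibid. Thm. 6.2 = Ribet Thm. 0).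

* §1 the cells `(8, 75)`, `(9, 74)`, `(14, 69)`, `(15, 68)`, `(17, 66)`, `(18, 65)`, `(19, 64)`, `(20, 63)`, `(21, 62)`, `(23, 60)`, `(25, 58)`, `(26, 57)`, `(27, 56)`, `(28, 55)`, `(29, 54)`, `(31, 52)`, `(32, 51)`, `(33, 50)`, `(34, 49)`, `(35, 48)`, `(37, 46)`, `(38, 45)`, `(39, 44)`, `(41, 42)` (and mirrors), the Hodge conjecture for these
  powers, 83-FOLDS of these signatures.
* §2 `isDivisorGenerated_powSucc_of_isSimple_eightythreefold'` (granted only `End⁰ = ℚ`),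
  `isDivisorGenerated_powSucc_of_isSimple_eightythreefold_of_finrank_endAlgebra_ne_one`,
  `hodgeConjectureFor_powSucc_of_isSimple_eightythreefold_of_finrank_endAlgebra_ne_one`.

## References
* [Ribet1983] K. A. Ribet, Amer. J. Math. 105 (1983), Thm. 0 and Thm. 3.
* [Gordon1997] B. B. Gordon, *A survey of the Hodge conjecture for abelian varieties*, Thm. 6.3 (3) and Corollary.
* [MoonenZarhin1999LowDim] B. Moonen, Yu. Zarhin, Math. Ann. 315 (1999), §2 (2.4), Thm. (2.7).
* [Deligne2000] P. Deligne, *The Hodge conjecture* (Clay, 2000), §1.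
-/

noncomputable section

open CategoryTheory Module

namespace Literature.AlgebraicGeometry.HodgeTheory

open Literature.AlgebraicGeometry.Motives
open Literature.AlgebraicGeometry.Motives.HodgeStructure

section Cells

/-- **Ribet 1983 Thm. 3 at `(n′, n″) = (8, 75)` — UNCONDITIONAL** (core `UnitaryEightSeventyFive.eq_top_of_smul`).
[cite: Ribet1983, Thm. 0 and Thm. 3] [cite: Gordon1997, Thm. 6.3 (3) and Corollary] -/
theorem AbelianVariety.isDivisorGenerated_powSucc_of_ribetTypeEightSeventyFive (A : AbelianVariety ℂ) (φ : A ⟶ A)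
    {d : ℕ} (hd : 0 < d) (hφ : φ ≫ φ = -(d • 𝟙 A)) (hE2 : Module.finrank ℚ A.endAlgebra = 2)
    (h8 : eigenMultiplicity A φ (Complex.I * (Real.sqrt d : ℂ)) = 8)
    (h75 : eigenMultiplicity A φ (-(Complex.I * (Real.sqrt d : ℂ))) = 75) (N : ℕ) :
    IsDivisorGenerated (A.powSucc N) := by
  refine AbelianVariety.isDivisorGenerated_powSucc_of_ribetType_ofCoreSmul A φ hd hφ hE2 (by omega) (by omega) ?_ N
  intro W' _ _ _ 𝔊 ι P' Q' s hbr hirr hι hιι hP' hQ' hfinP' hfinQ' hadd hsmul hsymm hPQ hdefP hdefQ hadj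
  exact UnitaryEightSeventyFive.eq_top_of_smul hbr hirr hι hιι hP' hQ' (by rw [hfinP', h8]) (by rw [hfinQ', h75]) hadd
    hsmul hsymm hPQ hdefP hdefQ hadj

/-- The mirror: `n_{i√d}(φ) = 75`, `n_{−i√d}(φ) = 8` (core `UnitaryEightSeventyFive.eq_top_of_smul'`).
[cite: Ribet1983, Thm. 0 and Thm. 3] [cite: Gordon1997, Thm. 6.3 (3) and Corollary] -/
theorem AbelianVariety.isDivisorGenerated_powSucc_of_ribetTypeEightSeventyFive' (A : AbelianVariety ℂ) (φ : A ⟶ A)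
    {d : ℕ} (hd : 0 < d) (hφ : φ ≫ φ = -(d • 𝟙 A)) (hE2 : Module.finrank ℚ A.endAlgebra = 2)
    (h75 : eigenMultiplicity A φ (Complex.I * (Real.sqrt d : ℂ)) = 75)
    (h8 : eigenMultiplicity A φ (-(Complex.I * (Real.sqrt d : ℂ))) = 8) (N : ℕ) :
    IsDivisorGenerated (A.powSucc N) := by
  refine AbelianVariety.isDivisorGenerated_powSucc_of_ribetType_ofCoreSmul A φ hd hφ hE2 (by omega) (by omega) ?_ N
  intro W' _ _ _ 𝔊 ι P' Q' s hbr hirr hι hιι hP' hQ' hfinP' hfinQ' hadd hsmul hsymm hPQ hdefP hdefQ hadj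
  exact UnitaryEightSeventyFive.eq_top_of_smul' hbr hirr hι hιι hP' hQ' (by rw [hfinP', h75]) (by rw [hfinQ', h8])
    hadd hsmul hsymm hPQ hdefP hdefQ hadj

/-- **The Hodge conjecture for all powers `A^{N+1}` of an abelian variety of Ribet type `(8, 75)` — UNCONDITIONAL.**
[cite: Ribet1983, Thm. 3] [cite: Deligne2000, §1] -/
theorem hodgeConjectureFor_powSucc_of_ribetTypeEightSeventyFive (A : AbelianVariety ℂ) (φ : A ⟶ A)
    {d : ℕ} (hd : 0 < d) (hφ : φ ≫ φ = -(d • 𝟙 A)) (hE2 : Module.finrank ℚ A.endAlgebra = 2)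
    (h8 : eigenMultiplicity A φ (Complex.I * (Real.sqrt d : ℂ)) = 8)
    (h75 : eigenMultiplicity A φ (-(Complex.I * (Real.sqrt d : ℂ))) = 75) (N : ℕ) :
    HodgeConjectureFor (A.powSucc N).dim (A.powSucc N).X :=
  hodgeConjectureFor_of_isDivisorGenerated _
    (AbelianVariety.isDivisorGenerated_powSucc_of_ribetTypeEightSeventyFive A φ hd hφ hE2 h8 h75 N)

/-- **83-FOLDS of signature `{8, 75}`: `B• = D•` on all powers — UNCONDITIONAL** (either eigenvalue may carry the `8`).
[cite: Ribet1983, Thm. 0 and Thm. 3] [cite: MoonenZarhin1999LowDim, §2 (2.4)] -/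
theorem AbelianVariety.isDivisorGenerated_powSucc_of_eightythreefold_eightSeventyFive (A : AbelianVariety ℂ)
    (φ : A ⟶ A) {d : ℕ} (hd : 0 < d) (hφ : φ ≫ φ = -(d • 𝟙 A)) (hE2 : Module.finrank ℚ A.endAlgebra = 2)
    (hX : A.dim = 83)
    (h8 : eigenMultiplicity A φ (Complex.I * (Real.sqrt d : ℂ)) = 8 ∨
      eigenMultiplicity A φ (-(Complex.I * (Real.sqrt d : ℂ))) = 8)
    (N : ℕ) : IsDivisorGenerated (A.powSucc N) := by
  have hsum := eigenMultiplicity_add_eigenMultiplicity_neg_eq_dim A φ hd hφ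
  rw [hX] at hsum
  rcases h8 with h | h
  · exact AbelianVariety.isDivisorGenerated_powSucc_of_ribetTypeEightSeventyFive A φ hd hφ hE2 h (by omega) N
  · exact AbelianVariety.isDivisorGenerated_powSucc_of_ribetTypeEightSeventyFive' A φ hd hφ hE2 (by omega) h N

/-- **The Hodge conjecture for all powers of a 83-FOLD of signature `{8, 75}` — UNCONDITIONAL.**
[cite: Ribet1983, Thm. 3] [cite: Deligne2000, §1] -/
theorem hodgeConjectureFor_powSucc_of_eightythreefold_eightSeventyFive (A : AbelianVariety ℂ)
    (φ : A ⟶ A) {d : ℕ} (hd : 0 < d) (hφ : φ ≫ φ = -(d • 𝟙 A)) (hE2 : Module.finrank ℚ A.endAlgebra = 2)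
    (hX : A.dim = 83)
    (h8 : eigenMultiplicity A φ (Complex.I * (Real.sqrt d : ℂ)) = 8 ∨
      eigenMultiplicity A φ (-(Complex.I * (Real.sqrt d : ℂ))) = 8)
    (N : ℕ) : HodgeConjectureFor (A.powSucc N).dim (A.powSucc N).X :=
  hodgeConjectureFor_of_isDivisorGenerated _
    (AbelianVariety.isDivisorGenerated_powSucc_of_eightythreefold_eightSeventyFive A φ hd hφ hE2 hX h8 N)

/-- **Ribet 1983 Thm. 3 at `(n′, n″) = (9, 74)` — UNCONDITIONAL** (core `UnitaryNineSeventyFour.eq_top_of_smul`).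
[cite: Ribet1983, Thm. 0 and Thm. 3] [cite: Gordon1997, Thm. 6.3 (3) and Corollary] -/
theorem AbelianVariety.isDivisorGenerated_powSucc_of_ribetTypeNineSeventyFour (A : AbelianVariety ℂ) (φ : A ⟶ A)
    {d : ℕ} (hd : 0 < d) (hφ : φ ≫ φ = -(d • 𝟙 A)) (hE2 : Module.finrank ℚ A.endAlgebra = 2)
    (h9 : eigenMultiplicity A φ (Complex.I * (Real.sqrt d : ℂ)) = 9)
    (h74 : eigenMultiplicity A φ (-(Complex.I * (Real.sqrt d : ℂ))) = 74) (N : ℕ) :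
    IsDivisorGenerated (A.powSucc N) := by
  refine AbelianVariety.isDivisorGenerated_powSucc_of_ribetType_ofCoreSmul A φ hd hφ hE2 (by omega) (by omega) ?_ N
  intro W' _ _ _ 𝔊 ι P' Q' s hbr hirr hι hιι hP' hQ' hfinP' hfinQ' hadd hsmul hsymm hPQ hdefP hdefQ hadj
  exact UnitaryNineSeventyFour.eq_top_of_smul hbr hirr hι hιι hP' hQ' (by rw [hfinP', h9]) (by rw [hfinQ', h74]) hadd
    hsmul hsymm hPQ hdefP hdefQ hadj

/-- The mirror: `n_{i√d}(φ) = 74`, `n_{−i√d}(φ) = 9` (core `UnitaryNineSeventyFour.eq_top_of_smul'`).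
[cite: Ribet1983, Thm. 0 and Thm. 3] [cite: Gordon1997, Thm. 6.3 (3) and Corollary] -/
theorem AbelianVariety.isDivisorGenerated_powSucc_of_ribetTypeNineSeventyFour' (A : AbelianVariety ℂ) (φ : A ⟶ A)
    {d : ℕ} (hd : 0 < d) (hφ : φ ≫ φ = -(d • 𝟙 A)) (hE2 : Module.finrank ℚ A.endAlgebra = 2)
    (h74 : eigenMultiplicity A φ (Complex.I * (Real.sqrt d : ℂ)) = 74)
    (h9 : eigenMultiplicity A φ (-(Complex.I * (Real.sqrt d : ℂ))) = 9) (N : ℕ) :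
    IsDivisorGenerated (A.powSucc N) := by
  refine AbelianVariety.isDivisorGenerated_powSucc_of_ribetType_ofCoreSmul A φ hd hφ hE2 (by omega) (by omega) ?_ N
  intro W' _ _ _ 𝔊 ι P' Q' s hbr hirr hι hιι hP' hQ' hfinP' hfinQ' hadd hsmul hsymm hPQ hdefP hdefQ hadj
  exact UnitaryNineSeventyFour.eq_top_of_smul' hbr hirr hι hιι hP' hQ' (by rw [hfinP', h74]) (by rw [hfinQ', h9])
    hadd hsmul hsymm hPQ hdefP hdefQ hadj

/-- **The Hodge conjecture for all powers `A^{N+1}` of an abelian variety of Ribet type `(9, 74)` — UNCONDITIONAL.**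
[cite: Ribet1983, Thm. 3] [cite: Deligne2000, §1] -/
theorem hodgeConjectureFor_powSucc_of_ribetTypeNineSeventyFour (A : AbelianVariety ℂ) (φ : A ⟶ A)
    {d : ℕ} (hd : 0 < d) (hφ : φ ≫ φ = -(d • 𝟙 A)) (hE2 : Module.finrank ℚ A.endAlgebra = 2)
    (h9 : eigenMultiplicity A φ (Complex.I * (Real.sqrt d : ℂ)) = 9)
    (h74 : eigenMultiplicity A φ (-(Complex.I * (Real.sqrt d : ℂ))) = 74) (N : ℕ) :
    HodgeConjectureFor (A.powSucc N).dim (A.powSucc N).X :=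
  hodgeConjectureFor_of_isDivisorGenerated _
    (AbelianVariety.isDivisorGenerated_powSucc_of_ribetTypeNineSeventyFour A φ hd hφ hE2 h9 h74 N)

/-- **83-FOLDS of signature `{9, 74}`: `B• = D•` on all powers — UNCONDITIONAL** (either eigenvalue may carry the `9`).
[cite: Ribet1983, Thm. 0 and Thm. 3] [cite: MoonenZarhin1999LowDim, §2 (2.4)] -/
theorem AbelianVariety.isDivisorGenerated_powSucc_of_eightythreefold_nineSeventyFour (A : AbelianVariety ℂ)
    (φ : A ⟶ A) {d : ℕ} (hd : 0 < d) (hφ : φ ≫ φ = -(d • 𝟙 A)) (hE2 : Module.finrank ℚ A.endAlgebra = 2)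
    (hX : A.dim = 83)
    (h9 : eigenMultiplicity A φ (Complex.I * (Real.sqrt d : ℂ)) = 9 ∨
      eigenMultiplicity A φ (-(Complex.I * (Real.sqrt d : ℂ))) = 9)
    (N : ℕ) : IsDivisorGenerated (A.powSucc N) := by
  have hsum := eigenMultiplicity_add_eigenMultiplicity_neg_eq_dim A φ hd hφ
  rw [hX] at hsum
  rcases h9 with h | h
  · exact AbelianVariety.isDivisorGenerated_powSucc_of_ribetTypeNineSeventyFour A φ hd hφ hE2 h (by omega) N
  · exact AbelianVariety.isDivisorGenerated_powSucc_of_ribetTypeNineSeventyFour' A φ hd hφ hE2 (by omega) h N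

/-- **The Hodge conjecture for all powers of a 83-FOLD of signature `{9, 74}` — UNCONDITIONAL.**
[cite: Ribet1983, Thm. 3] [cite: Deligne2000, §1] -/
theorem hodgeConjectureFor_powSucc_of_eightythreefold_nineSeventyFour (A : AbelianVariety ℂ)
    (φ : A ⟶ A) {d : ℕ} (hd : 0 < d) (hφ : φ ≫ φ = -(d • 𝟙 A)) (hE2 : Module.finrank ℚ A.endAlgebra = 2)
    (hX : A.dim = 83)
    (h9 : eigenMultiplicity A φ (Complex.I * (Real.sqrt d : ℂ)) = 9 ∨
      eigenMultiplicity A φ (-(Complex.I * (Real.sqrt d : ℂ))) = 9)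
    (N : ℕ) : HodgeConjectureFor (A.powSucc N).dim (A.powSucc N).X :=
  hodgeConjectureFor_of_isDivisorGenerated _
    (AbelianVariety.isDivisorGenerated_powSucc_of_eightythreefold_nineSeventyFour A φ hd hφ hE2 hX h9 N)

/-- **Ribet 1983 Thm. 3 at `(n′, n″) = (14, 69)` — UNCONDITIONAL** (core `UnitaryFourteenSixtyNine.eq_top_of_smul`).
[cite: Ribet1983, Thm. 0 and Thm. 3] [cite: Gordon1997, Thm. 6.3 (3) and Corollary] -/
theorem AbelianVariety.isDivisorGenerated_powSucc_of_ribetTypeFourteenSixtyNine (A : AbelianVariety ℂ) (φ : A ⟶ A)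
    {d : ℕ} (hd : 0 < d) (hφ : φ ≫ φ = -(d • 𝟙 A)) (hE2 : Module.finrank ℚ A.endAlgebra = 2)
    (h14 : eigenMultiplicity A φ (Complex.I * (Real.sqrt d : ℂ)) = 14)
    (h69 : eigenMultiplicity A φ (-(Complex.I * (Real.sqrt d : ℂ))) = 69) (N : ℕ) :
    IsDivisorGenerated (A.powSucc N) := by
  refine AbelianVariety.isDivisorGenerated_powSucc_of_ribetType_ofCoreSmul A φ hd hφ hE2 (by omega) (by omega) ?_ N
  intro W' _ _ _ 𝔊 ι P' Q' s hbr hirr hι hιι hP' hQ' hfinP' hfinQ' hadd hsmul hsymm hPQ hdefP hdefQ hadj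
  exact UnitaryFourteenSixtyNine.eq_top_of_smul hbr hirr hι hιι hP' hQ' (by rw [hfinP', h14]) (by rw [hfinQ', h69]) hadd
    hsmul hsymm hPQ hdefP hdefQ hadj

/-- The mirror: `n_{i√d}(φ) = 69`, `n_{−i√d}(φ) = 14` (core `UnitaryFourteenSixtyNine.eq_top_of_smul'`).
[cite: Ribet1983, Thm. 0 and Thm. 3] [cite: Gordon1997, Thm. 6.3 (3) and Corollary] -/
theorem AbelianVariety.isDivisorGenerated_powSucc_of_ribetTypeFourteenSixtyNine' (A : AbelianVariety ℂ) (φ : A ⟶ A)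
    {d : ℕ} (hd : 0 < d) (hφ : φ ≫ φ = -(d • 𝟙 A)) (hE2 : Module.finrank ℚ A.endAlgebra = 2)
    (h69 : eigenMultiplicity A φ (Complex.I * (Real.sqrt d : ℂ)) = 69)
    (h14 : eigenMultiplicity A φ (-(Complex.I * (Real.sqrt d : ℂ))) = 14) (N : ℕ) :
    IsDivisorGenerated (A.powSucc N) := by
  refine AbelianVariety.isDivisorGenerated_powSucc_of_ribetType_ofCoreSmul A φ hd hφ hE2 (by omega) (by omega) ?_ N
  intro W' _ _ _ 𝔊 ι P' Q' s hbr hirr hι hιι hP' hQ' hfinP' hfinQ' hadd hsmul hsymm hPQ hdefP hdefQ hadj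
  exact UnitaryFourteenSixtyNine.eq_top_of_smul' hbr hirr hι hιι hP' hQ' (by rw [hfinP', h69]) (by rw [hfinQ', h14])
    hadd hsmul hsymm hPQ hdefP hdefQ hadj

/-- **The Hodge conjecture for all powers `A^{N+1}` of an abelian variety of Ribet type `(14, 69)` — UNCONDITIONAL.**
[cite: Ribet1983, Thm. 3] [cite: Deligne2000, §1] -/
theorem hodgeConjectureFor_powSucc_of_ribetTypeFourteenSixtyNine (A : AbelianVariety ℂ) (φ : A ⟶ A)
    {d : ℕ} (hd : 0 < d) (hφ : φ ≫ φ = -(d • 𝟙 A)) (hE2 : Module.finrank ℚ A.endAlgebra = 2)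
    (h14 : eigenMultiplicity A φ (Complex.I * (Real.sqrt d : ℂ)) = 14)
    (h69 : eigenMultiplicity A φ (-(Complex.I * (Real.sqrt d : ℂ))) = 69) (N : ℕ) :
    HodgeConjectureFor (A.powSucc N).dim (A.powSucc N).X :=
  hodgeConjectureFor_of_isDivisorGenerated _
    (AbelianVariety.isDivisorGenerated_powSucc_of_ribetTypeFourteenSixtyNine A φ hd hφ hE2 h14 h69 N)

/-- **83-FOLDS of signature `{14, 69}`: `B• = D•` on all powers — UNCONDITIONAL** (either eigenvalue may carry the `14`).
[cite: Ribet1983, Thm. 0 and Thm. 3] [cite: MoonenZarhin1999LowDim, §2 (2.4)] -/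
theorem AbelianVariety.isDivisorGenerated_powSucc_of_eightythreefold_fourteenSixtyNine (A : AbelianVariety ℂ)
    (φ : A ⟶ A) {d : ℕ} (hd : 0 < d) (hφ : φ ≫ φ = -(d • 𝟙 A)) (hE2 : Module.finrank ℚ A.endAlgebra = 2)
    (hX : A.dim = 83)
    (h14 : eigenMultiplicity A φ (Complex.I * (Real.sqrt d : ℂ)) = 14 ∨
      eigenMultiplicity A φ (-(Complex.I * (Real.sqrt d : ℂ))) = 14)
    (N : ℕ) : IsDivisorGenerated (A.powSucc N) := by
  have hsum := eigenMultiplicity_add_eigenMultiplicity_neg_eq_dim A φ hd hφ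
  rw [hX] at hsum
  rcases h14 with h | h
  · exact AbelianVariety.isDivisorGenerated_powSucc_of_ribetTypeFourteenSixtyNine A φ hd hφ hE2 h (by omega) N
  · exact AbelianVariety.isDivisorGenerated_powSucc_of_ribetTypeFourteenSixtyNine' A φ hd hφ hE2 (by omega) h N

/-- **The Hodge conjecture for all powers of a 83-FOLD of signature `{14, 69}` — UNCONDITIONAL.**
[cite: Ribet1983, Thm. 3] [cite: Deligne2000, §1] -/
theorem hodgeConjectureFor_powSucc_of_eightythreefold_fourteenSixtyNine (A : AbelianVariety ℂ)
    (φ : A ⟶ A) {d : ℕ} (hd : 0 < d) (hφ : φ ≫ φ = -(d • 𝟙 A)) (hE2 : Module.finrank ℚ A.endAlgebra = 2)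
    (hX : A.dim = 83)
    (h14 : eigenMultiplicity A φ (Complex.I * (Real.sqrt d : ℂ)) = 14 ∨
      eigenMultiplicity A φ (-(Complex.I * (Real.sqrt d : ℂ))) = 14)
    (N : ℕ) : HodgeConjectureFor (A.powSucc N).dim (A.powSucc N).X :=
  hodgeConjectureFor_of_isDivisorGenerated _
    (AbelianVariety.isDivisorGenerated_powSucc_of_eightythreefold_fourteenSixtyNine A φ hd hφ hE2 hX h14 N)

/-- **Ribet 1983 Thm. 3 at `(n′, n″) = (15, 68)` — UNCONDITIONAL** (core `UnitaryFifteenSixtyEight.eq_top_of_smul`).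
[cite: Ribet1983, Thm. 0 and Thm. 3] [cite: Gordon1997, Thm. 6.3 (3) and Corollary] -/
theorem AbelianVariety.isDivisorGenerated_powSucc_of_ribetTypeFifteenSixtyEight (A : AbelianVariety ℂ) (φ : A ⟶ A)
    {d : ℕ} (hd : 0 < d) (hφ : φ ≫ φ = -(d • 𝟙 A)) (hE2 : Module.finrank ℚ A.endAlgebra = 2)
    (h15 : eigenMultiplicity A φ (Complex.I * (Real.sqrt d : ℂ)) = 15)
    (h68 : eigenMultiplicity A φ (-(Complex.I * (Real.sqrt d : ℂ))) = 68) (N : ℕ) :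
    IsDivisorGenerated (A.powSucc N) := by
  refine AbelianVariety.isDivisorGenerated_powSucc_of_ribetType_ofCoreSmul A φ hd hφ hE2 (by omega) (by omega) ?_ N
  intro W' _ _ _ 𝔊 ι P' Q' s hbr hirr hι hιι hP' hQ' hfinP' hfinQ' hadd hsmul hsymm hPQ hdefP hdefQ hadj
  exact UnitaryFifteenSixtyEight.eq_top_of_smul hbr hirr hι hιι hP' hQ' (by rw [hfinP', h15]) (by rw [hfinQ', h68]) hadd
    hsmul hsymm hPQ hdefP hdefQ hadj

/-- The mirror: `n_{i√d}(φ) = 68`, `n_{−i√d}(φ) = 15` (core `UnitaryFifteenSixtyEight.eq_top_of_smul'`).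
[cite: Ribet1983, Thm. 0 and Thm. 3] [cite: Gordon1997, Thm. 6.3 (3) and Corollary] -/
theorem AbelianVariety.isDivisorGenerated_powSucc_of_ribetTypeFifteenSixtyEight' (A : AbelianVariety ℂ) (φ : A ⟶ A)
    {d : ℕ} (hd : 0 < d) (hφ : φ ≫ φ = -(d • 𝟙 A)) (hE2 : Module.finrank ℚ A.endAlgebra = 2)
    (h68 : eigenMultiplicity A φ (Complex.I * (Real.sqrt d : ℂ)) = 68)
    (h15 : eigenMultiplicity A φ (-(Complex.I * (Real.sqrt d : ℂ))) = 15) (N : ℕ) :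
    IsDivisorGenerated (A.powSucc N) := by
  refine AbelianVariety.isDivisorGenerated_powSucc_of_ribetType_ofCoreSmul A φ hd hφ hE2 (by omega) (by omega) ?_ N
  intro W' _ _ _ 𝔊 ι P' Q' s hbr hirr hι hιι hP' hQ' hfinP' hfinQ' hadd hsmul hsymm hPQ hdefP hdefQ hadj
  exact UnitaryFifteenSixtyEight.eq_top_of_smul' hbr hirr hι hιι hP' hQ' (by rw [hfinP', h68]) (by rw [hfinQ', h15])
    hadd hsmul hsymm hPQ hdefP hdefQ hadj

/-- **The Hodge conjecture for all powers `A^{N+1}` of an abelian variety of Ribet type `(15, 68)` — UNCONDITIONAL.**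
[cite: Ribet1983, Thm. 3] [cite: Deligne2000, §1] -/
theorem hodgeConjectureFor_powSucc_of_ribetTypeFifteenSixtyEight (A : AbelianVariety ℂ) (φ : A ⟶ A)
    {d : ℕ} (hd : 0 < d) (hφ : φ ≫ φ = -(d • 𝟙 A)) (hE2 : Module.finrank ℚ A.endAlgebra = 2)
    (h15 : eigenMultiplicity A φ (Complex.I * (Real.sqrt d : ℂ)) = 15)
    (h68 : eigenMultiplicity A φ (-(Complex.I * (Real.sqrt d : ℂ))) = 68) (N : ℕ) :
    HodgeConjectureFor (A.powSucc N).dim (A.powSucc N).X :=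
  hodgeConjectureFor_of_isDivisorGenerated _
    (AbelianVariety.isDivisorGenerated_powSucc_of_ribetTypeFifteenSixtyEight A φ hd hφ hE2 h15 h68 N)

/-- **83-FOLDS of signature `{15, 68}`: `B• = D•` on all powers — UNCONDITIONAL** (either eigenvalue may carry the `15`).
[cite: Ribet1983, Thm. 0 and Thm. 3] [cite: MoonenZarhin1999LowDim, §2 (2.4)] -/
theorem AbelianVariety.isDivisorGenerated_powSucc_of_eightythreefold_fifteenSixtyEight (A : AbelianVariety ℂ)
    (φ : A ⟶ A) {d : ℕ} (hd : 0 < d) (hφ : φ ≫ φ = -(d • 𝟙 A)) (hE2 : Module.finrank ℚ A.endAlgebra = 2)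
    (hX : A.dim = 83)
    (h15 : eigenMultiplicity A φ (Complex.I * (Real.sqrt d : ℂ)) = 15 ∨
      eigenMultiplicity A φ (-(Complex.I * (Real.sqrt d : ℂ))) = 15)
    (N : ℕ) : IsDivisorGenerated (A.powSucc N) := by
  have hsum := eigenMultiplicity_add_eigenMultiplicity_neg_eq_dim A φ hd hφ
  rw [hX] at hsum
  rcases h15 with h | h
  · exact AbelianVariety.isDivisorGenerated_powSucc_of_ribetTypeFifteenSixtyEight A φ hd hφ hE2 h (by omega) N
  · exact AbelianVariety.isDivisorGenerated_powSucc_of_ribetTypeFifteenSixtyEight' A φ hd hφ hE2 (by omega) h N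

/-- **The Hodge conjecture for all powers of a 83-FOLD of signature `{15, 68}` — UNCONDITIONAL.**
[cite: Ribet1983, Thm. 3] [cite: Deligne2000, §1] -/
theorem hodgeConjectureFor_powSucc_of_eightythreefold_fifteenSixtyEight (A : AbelianVariety ℂ)
    (φ : A ⟶ A) {d : ℕ} (hd : 0 < d) (hφ : φ ≫ φ = -(d • 𝟙 A)) (hE2 : Module.finrank ℚ A.endAlgebra = 2)
    (hX : A.dim = 83)
    (h15 : eigenMultiplicity A φ (Complex.I * (Real.sqrt d : ℂ)) = 15 ∨
      eigenMultiplicity A φ (-(Complex.I * (Real.sqrt d : ℂ))) = 15)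
    (N : ℕ) : HodgeConjectureFor (A.powSucc N).dim (A.powSucc N).X :=
  hodgeConjectureFor_of_isDivisorGenerated _
    (AbelianVariety.isDivisorGenerated_powSucc_of_eightythreefold_fifteenSixtyEight A φ hd hφ hE2 hX h15 N)

/-- **Ribet 1983 Thm. 3 at `(n′, n″) = (17, 66)` — UNCONDITIONAL** (core `UnitarySeventeenSixtySix.eq_top_of_smul`).
[cite: Ribet1983, Thm. 0 and Thm. 3] [cite: Gordon1997, Thm. 6.3 (3) and Corollary] -/
theorem AbelianVariety.isDivisorGenerated_powSucc_of_ribetTypeSeventeenSixtySix (A : AbelianVariety ℂ) (φ : A ⟶ A)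
    {d : ℕ} (hd : 0 < d) (hφ : φ ≫ φ = -(d • 𝟙 A)) (hE2 : Module.finrank ℚ A.endAlgebra = 2)
    (h17 : eigenMultiplicity A φ (Complex.I * (Real.sqrt d : ℂ)) = 17)
    (h66 : eigenMultiplicity A φ (-(Complex.I * (Real.sqrt d : ℂ))) = 66) (N : ℕ) :
    IsDivisorGenerated (A.powSucc N) := by
  refine AbelianVariety.isDivisorGenerated_powSucc_of_ribetType_ofCoreSmul A φ hd hφ hE2 (by omega) (by omega) ?_ N
  intro W' _ _ _ 𝔊 ι P' Q' s hbr hirr hι hιι hP' hQ' hfinP' hfinQ' hadd hsmul hsymm hPQ hdefP hdefQ hadj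
  exact UnitarySeventeenSixtySix.eq_top_of_smul hbr hirr hι hιι hP' hQ' (by rw [hfinP', h17]) (by rw [hfinQ', h66]) hadd
    hsmul hsymm hPQ hdefP hdefQ hadj

/-- The mirror: `n_{i√d}(φ) = 66`, `n_{−i√d}(φ) = 17` (core `UnitarySeventeenSixtySix.eq_top_of_smul'`).
[cite: Ribet1983, Thm. 0 and Thm. 3] [cite: Gordon1997, Thm. 6.3 (3) and Corollary] -/
theorem AbelianVariety.isDivisorGenerated_powSucc_of_ribetTypeSeventeenSixtySix' (A : AbelianVariety ℂ) (φ : A ⟶ A)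
    {d : ℕ} (hd : 0 < d) (hφ : φ ≫ φ = -(d • 𝟙 A)) (hE2 : Module.finrank ℚ A.endAlgebra = 2)
    (h66 : eigenMultiplicity A φ (Complex.I * (Real.sqrt d : ℂ)) = 66)
    (h17 : eigenMultiplicity A φ (-(Complex.I * (Real.sqrt d : ℂ))) = 17) (N : ℕ) :
    IsDivisorGenerated (A.powSucc N) := by
  refine AbelianVariety.isDivisorGenerated_powSucc_of_ribetType_ofCoreSmul A φ hd hφ hE2 (by omega) (by omega) ?_ N
  intro W' _ _ _ 𝔊 ι P' Q' s hbr hirr hι hιι hP' hQ' hfinP' hfinQ' hadd hsmul hsymm hPQ hdefP hdefQ hadj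
  exact UnitarySeventeenSixtySix.eq_top_of_smul' hbr hirr hι hιι hP' hQ' (by rw [hfinP', h66]) (by rw [hfinQ', h17])
    hadd hsmul hsymm hPQ hdefP hdefQ hadj

/-- **The Hodge conjecture for all powers `A^{N+1}` of an abelian variety of Ribet type `(17, 66)` — UNCONDITIONAL.**
[cite: Ribet1983, Thm. 3] [cite: Deligne2000, §1] -/
theorem hodgeConjectureFor_powSucc_of_ribetTypeSeventeenSixtySix (A : AbelianVariety ℂ) (φ : A ⟶ A)
    {d : ℕ} (hd : 0 < d) (hφ : φ ≫ φ = -(d • 𝟙 A)) (hE2 : Module.finrank ℚ A.endAlgebra = 2)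
    (h17 : eigenMultiplicity A φ (Complex.I * (Real.sqrt d : ℂ)) = 17)
    (h66 : eigenMultiplicity A φ (-(Complex.I * (Real.sqrt d : ℂ))) = 66) (N : ℕ) :
    HodgeConjectureFor (A.powSucc N).dim (A.powSucc N).X :=
  hodgeConjectureFor_of_isDivisorGenerated _
    (AbelianVariety.isDivisorGenerated_powSucc_of_ribetTypeSeventeenSixtySix A φ hd hφ hE2 h17 h66 N)

/-- **83-FOLDS of signature `{17, 66}`: `B• = D•` on all powers — UNCONDITIONAL** (either eigenvalue may carry the `17`).
[cite: Ribet1983, Thm. 0 and Thm. 3] [cite: MoonenZarhin1999LowDim, §2 (2.4)] -/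
theorem AbelianVariety.isDivisorGenerated_powSucc_of_eightythreefold_seventeenSixtySix (A : AbelianVariety ℂ)
    (φ : A ⟶ A) {d : ℕ} (hd : 0 < d) (hφ : φ ≫ φ = -(d • 𝟙 A)) (hE2 : Module.finrank ℚ A.endAlgebra = 2)
    (hX : A.dim = 83)
    (h17 : eigenMultiplicity A φ (Complex.I * (Real.sqrt d : ℂ)) = 17 ∨
      eigenMultiplicity A φ (-(Complex.I * (Real.sqrt d : ℂ))) = 17)
    (N : ℕ) : IsDivisorGenerated (A.powSucc N) := by
  have hsum := eigenMultiplicity_add_eigenMultiplicity_neg_eq_dim A φ hd hφ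
  rw [hX] at hsum
  rcases h17 with h | h
  · exact AbelianVariety.isDivisorGenerated_powSucc_of_ribetTypeSeventeenSixtySix A φ hd hφ hE2 h (by omega) N
  · exact AbelianVariety.isDivisorGenerated_powSucc_of_ribetTypeSeventeenSixtySix' A φ hd hφ hE2 (by omega) h N

/-- **The Hodge conjecture for all powers of a 83-FOLD of signature `{17, 66}` — UNCONDITIONAL.**
[cite: Ribet1983, Thm. 3] [cite: Deligne2000, §1] -/
theorem hodgeConjectureFor_powSucc_of_eightythreefold_seventeenSixtySix (A : AbelianVariety ℂ)
    (φ : A ⟶ A) {d : ℕ} (hd : 0 < d) (hφ : φ ≫ φ = -(d • 𝟙 A)) (hE2 : Module.finrank ℚ A.endAlgebra = 2)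
    (hX : A.dim = 83)
    (h17 : eigenMultiplicity A φ (Complex.I * (Real.sqrt d : ℂ)) = 17 ∨
      eigenMultiplicity A φ (-(Complex.I * (Real.sqrt d : ℂ))) = 17)
    (N : ℕ) : HodgeConjectureFor (A.powSucc N).dim (A.powSucc N).X :=
  hodgeConjectureFor_of_isDivisorGenerated _
    (AbelianVariety.isDivisorGenerated_powSucc_of_eightythreefold_seventeenSixtySix A φ hd hφ hE2 hX h17 N)

/-- **Ribet 1983 Thm. 3 at `(n′, n″) = (18, 65)` — UNCONDITIONAL** (core `UnitaryEighteenSixtyFive.eq_top_of_smul`).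
[cite: Ribet1983, Thm. 0 and Thm. 3] [cite: Gordon1997, Thm. 6.3 (3) and Corollary] -/
theorem AbelianVariety.isDivisorGenerated_powSucc_of_ribetTypeEighteenSixtyFive (A : AbelianVariety ℂ) (φ : A ⟶ A)
    {d : ℕ} (hd : 0 < d) (hφ : φ ≫ φ = -(d • 𝟙 A)) (hE2 : Module.finrank ℚ A.endAlgebra = 2)
    (h18 : eigenMultiplicity A φ (Complex.I * (Real.sqrt d : ℂ)) = 18)
    (h65 : eigenMultiplicity A φ (-(Complex.I * (Real.sqrt d : ℂ))) = 65) (N : ℕ) :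
    IsDivisorGenerated (A.powSucc N) := by
  refine AbelianVariety.isDivisorGenerated_powSucc_of_ribetType_ofCoreSmul A φ hd hφ hE2 (by omega) (by omega) ?_ N
  intro W' _ _ _ 𝔊 ι P' Q' s hbr hirr hι hιι hP' hQ' hfinP' hfinQ' hadd hsmul hsymm hPQ hdefP hdefQ hadj
  exact UnitaryEighteenSixtyFive.eq_top_of_smul hbr hirr hι hιι hP' hQ' (by rw [hfinP', h18]) (by rw [hfinQ', h65]) hadd
    hsmul hsymm hPQ hdefP hdefQ hadj

/-- The mirror: `n_{i√d}(φ) = 65`, `n_{−i√d}(φ) = 18` (core `UnitaryEighteenSixtyFive.eq_top_of_smul'`).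
[cite: Ribet1983, Thm. 0 and Thm. 3] [cite: Gordon1997, Thm. 6.3 (3) and Corollary] -/
theorem AbelianVariety.isDivisorGenerated_powSucc_of_ribetTypeEighteenSixtyFive' (A : AbelianVariety ℂ) (φ : A ⟶ A)
    {d : ℕ} (hd : 0 < d) (hφ : φ ≫ φ = -(d • 𝟙 A)) (hE2 : Module.finrank ℚ A.endAlgebra = 2)
    (h65 : eigenMultiplicity A φ (Complex.I * (Real.sqrt d : ℂ)) = 65)
    (h18 : eigenMultiplicity A φ (-(Complex.I * (Real.sqrt d : ℂ))) = 18) (N : ℕ) :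
    IsDivisorGenerated (A.powSucc N) := by
  refine AbelianVariety.isDivisorGenerated_powSucc_of_ribetType_ofCoreSmul A φ hd hφ hE2 (by omega) (by omega) ?_ N
  intro W' _ _ _ 𝔊 ι P' Q' s hbr hirr hι hιι hP' hQ' hfinP' hfinQ' hadd hsmul hsymm hPQ hdefP hdefQ hadj
  exact UnitaryEighteenSixtyFive.eq_top_of_smul' hbr hirr hι hιι hP' hQ' (by rw [hfinP', h65]) (by rw [hfinQ', h18])
    hadd hsmul hsymm hPQ hdefP hdefQ hadj

/-- **The Hodge conjecture for all powers `A^{N+1}` of an abelian variety of Ribet type `(18, 65)` — UNCONDITIONAL.**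
[cite: Ribet1983, Thm. 3] [cite: Deligne2000, §1] -/
theorem hodgeConjectureFor_powSucc_of_ribetTypeEighteenSixtyFive (A : AbelianVariety ℂ) (φ : A ⟶ A)
    {d : ℕ} (hd : 0 < d) (hφ : φ ≫ φ = -(d • 𝟙 A)) (hE2 : Module.finrank ℚ A.endAlgebra = 2)
    (h18 : eigenMultiplicity A φ (Complex.I * (Real.sqrt d : ℂ)) = 18)
    (h65 : eigenMultiplicity A φ (-(Complex.I * (Real.sqrt d : ℂ))) = 65) (N : ℕ) :
    HodgeConjectureFor (A.powSucc N).dim (A.powSucc N).X :=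
  hodgeConjectureFor_of_isDivisorGenerated _
    (AbelianVariety.isDivisorGenerated_powSucc_of_ribetTypeEighteenSixtyFive A φ hd hφ hE2 h18 h65 N)

/-- **83-FOLDS of signature `{18, 65}`: `B• = D•` on all powers — UNCONDITIONAL** (either eigenvalue may carry the `18`).
[cite: Ribet1983, Thm. 0 and Thm. 3] [cite: MoonenZarhin1999LowDim, §2 (2.4)] -/
theorem AbelianVariety.isDivisorGenerated_powSucc_of_eightythreefold_eighteenSixtyFive (A : AbelianVariety ℂ)
    (φ : A ⟶ A) {d : ℕ} (hd : 0 < d) (hφ : φ ≫ φ = -(d • 𝟙 A)) (hE2 : Module.finrank ℚ A.endAlgebra = 2)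
    (hX : A.dim = 83)
    (h18 : eigenMultiplicity A φ (Complex.I * (Real.sqrt d : ℂ)) = 18 ∨
      eigenMultiplicity A φ (-(Complex.I * (Real.sqrt d : ℂ))) = 18)
    (N : ℕ) : IsDivisorGenerated (A.powSucc N) := by
  have hsum := eigenMultiplicity_add_eigenMultiplicity_neg_eq_dim A φ hd hφ
  rw [hX] at hsum
  rcases h18 with h | h
  · exact AbelianVariety.isDivisorGenerated_powSucc_of_ribetTypeEighteenSixtyFive A φ hd hφ hE2 h (by omega) N
  · exact AbelianVariety.isDivisorGenerated_powSucc_of_ribetTypeEighteenSixtyFive' A φ hd hφ hE2 (by omega) h N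

/-- **The Hodge conjecture for all powers of a 83-FOLD of signature `{18, 65}` — UNCONDITIONAL.**
[cite: Ribet1983, Thm. 3] [cite: Deligne2000, §1] -/
theorem hodgeConjectureFor_powSucc_of_eightythreefold_eighteenSixtyFive (A : AbelianVariety ℂ)
    (φ : A ⟶ A) {d : ℕ} (hd : 0 < d) (hφ : φ ≫ φ = -(d • 𝟙 A)) (hE2 : Module.finrank ℚ A.endAlgebra = 2)
    (hX : A.dim = 83)
    (h18 : eigenMultiplicity A φ (Complex.I * (Real.sqrt d : ℂ)) = 18 ∨
      eigenMultiplicity A φ (-(Complex.I * (Real.sqrt d : ℂ))) = 18)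
    (N : ℕ) : HodgeConjectureFor (A.powSucc N).dim (A.powSucc N).X :=
  hodgeConjectureFor_of_isDivisorGenerated _
    (AbelianVariety.isDivisorGenerated_powSucc_of_eightythreefold_eighteenSixtyFive A φ hd hφ hE2 hX h18 N)

/-- **Ribet 1983 Thm. 3 at `(n′, n″) = (19, 64)` — UNCONDITIONAL** (core `UnitaryNineteenSixtyFour.eq_top_of_smul`).
[cite: Ribet1983, Thm. 0 and Thm. 3] [cite: Gordon1997, Thm. 6.3 (3) and Corollary] -/
theorem AbelianVariety.isDivisorGenerated_powSucc_of_ribetTypeNineteenSixtyFour (A : AbelianVariety ℂ) (φ : A ⟶ A)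
    {d : ℕ} (hd : 0 < d) (hφ : φ ≫ φ = -(d • 𝟙 A)) (hE2 : Module.finrank ℚ A.endAlgebra = 2)
    (h19 : eigenMultiplicity A φ (Complex.I * (Real.sqrt d : ℂ)) = 19)
    (h64 : eigenMultiplicity A φ (-(Complex.I * (Real.sqrt d : ℂ))) = 64) (N : ℕ) :
    IsDivisorGenerated (A.powSucc N) := by
  refine AbelianVariety.isDivisorGenerated_powSucc_of_ribetType_ofCoreSmul A φ hd hφ hE2 (by omega) (by omega) ?_ N
  intro W' _ _ _ 𝔊 ι P' Q' s hbr hirr hι hιι hP' hQ' hfinP' hfinQ' hadd hsmul hsymm hPQ hdefP hdefQ hadj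
  exact UnitaryNineteenSixtyFour.eq_top_of_smul hbr hirr hι hιι hP' hQ' (by rw [hfinP', h19]) (by rw [hfinQ', h64]) hadd
    hsmul hsymm hPQ hdefP hdefQ hadj

/-- The mirror: `n_{i√d}(φ) = 64`, `n_{−i√d}(φ) = 19` (core `UnitaryNineteenSixtyFour.eq_top_of_smul'`).
[cite: Ribet1983, Thm. 0 and Thm. 3] [cite: Gordon1997, Thm. 6.3 (3) and Corollary] -/
theorem AbelianVariety.isDivisorGenerated_powSucc_of_ribetTypeNineteenSixtyFour' (A : AbelianVariety ℂ) (φ : A ⟶ A)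
    {d : ℕ} (hd : 0 < d) (hφ : φ ≫ φ = -(d • 𝟙 A)) (hE2 : Module.finrank ℚ A.endAlgebra = 2)
    (h64 : eigenMultiplicity A φ (Complex.I * (Real.sqrt d : ℂ)) = 64)
    (h19 : eigenMultiplicity A φ (-(Complex.I * (Real.sqrt d : ℂ))) = 19) (N : ℕ) :
    IsDivisorGenerated (A.powSucc N) := by
  refine AbelianVariety.isDivisorGenerated_powSucc_of_ribetType_ofCoreSmul A φ hd hφ hE2 (by omega) (by omega) ?_ N
  intro W' _ _ _ 𝔊 ι P' Q' s hbr hirr hι hιι hP' hQ' hfinP' hfinQ' hadd hsmul hsymm hPQ hdefP hdefQ hadj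
  exact UnitaryNineteenSixtyFour.eq_top_of_smul' hbr hirr hι hιι hP' hQ' (by rw [hfinP', h64]) (by rw [hfinQ', h19])
    hadd hsmul hsymm hPQ hdefP hdefQ hadj

/-- **The Hodge conjecture for all powers `A^{N+1}` of an abelian variety of Ribet type `(19, 64)` — UNCONDITIONAL.**
[cite: Ribet1983, Thm. 3] [cite: Deligne2000, §1] -/
theorem hodgeConjectureFor_powSucc_of_ribetTypeNineteenSixtyFour (A : AbelianVariety ℂ) (φ : A ⟶ A)
    {d : ℕ} (hd : 0 < d) (hφ : φ ≫ φ = -(d • 𝟙 A)) (hE2 : Module.finrank ℚ A.endAlgebra = 2)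
    (h19 : eigenMultiplicity A φ (Complex.I * (Real.sqrt d : ℂ)) = 19)
    (h64 : eigenMultiplicity A φ (-(Complex.I * (Real.sqrt d : ℂ))) = 64) (N : ℕ) :
    HodgeConjectureFor (A.powSucc N).dim (A.powSucc N).X :=
  hodgeConjectureFor_of_isDivisorGenerated _
    (AbelianVariety.isDivisorGenerated_powSucc_of_ribetTypeNineteenSixtyFour A φ hd hφ hE2 h19 h64 N)

/-- **83-FOLDS of signature `{19, 64}`: `B• = D•` on all powers — UNCONDITIONAL** (either eigenvalue may carry the `19`).
[cite: Ribet1983, Thm. 0 and Thm. 3] [cite: MoonenZarhin1999LowDim, §2 (2.4)] -/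
theorem AbelianVariety.isDivisorGenerated_powSucc_of_eightythreefold_nineteenSixtyFour (A : AbelianVariety ℂ)
    (φ : A ⟶ A) {d : ℕ} (hd : 0 < d) (hφ : φ ≫ φ = -(d • 𝟙 A)) (hE2 : Module.finrank ℚ A.endAlgebra = 2)
    (hX : A.dim = 83)
    (h19 : eigenMultiplicity A φ (Complex.I * (Real.sqrt d : ℂ)) = 19 ∨
      eigenMultiplicity A φ (-(Complex.I * (Real.sqrt d : ℂ))) = 19)
    (N : ℕ) : IsDivisorGenerated (A.powSucc N) := by
  have hsum := eigenMultiplicity_add_eigenMultiplicity_neg_eq_dim A φ hd hφ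
  rw [hX] at hsum
  rcases h19 with h | h
  · exact AbelianVariety.isDivisorGenerated_powSucc_of_ribetTypeNineteenSixtyFour A φ hd hφ hE2 h (by omega) N
  · exact AbelianVariety.isDivisorGenerated_powSucc_of_ribetTypeNineteenSixtyFour' A φ hd hφ hE2 (by omega) h N

/-- **The Hodge conjecture for all powers of a 83-FOLD of signature `{19, 64}` — UNCONDITIONAL.**
[cite: Ribet1983, Thm. 3] [cite: Deligne2000, §1] -/
theorem hodgeConjectureFor_powSucc_of_eightythreefold_nineteenSixtyFour (A : AbelianVariety ℂ)
    (φ : A ⟶ A) {d : ℕ} (hd : 0 < d) (hφ : φ ≫ φ = -(d • 𝟙 A)) (hE2 : Module.finrank ℚ A.endAlgebra = 2)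
    (hX : A.dim = 83)
    (h19 : eigenMultiplicity A φ (Complex.I * (Real.sqrt d : ℂ)) = 19 ∨
      eigenMultiplicity A φ (-(Complex.I * (Real.sqrt d : ℂ))) = 19)
    (N : ℕ) : HodgeConjectureFor (A.powSucc N).dim (A.powSucc N).X :=
  hodgeConjectureFor_of_isDivisorGenerated _
    (AbelianVariety.isDivisorGenerated_powSucc_of_eightythreefold_nineteenSixtyFour A φ hd hφ hE2 hX h19 N)

/-- **Ribet 1983 Thm. 3 at `(n′, n″) = (20, 63)` — UNCONDITIONAL** (core `UnitaryTwentySixtyThree.eq_top_of_smul`).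
[cite: Ribet1983, Thm. 0 and Thm. 3] [cite: Gordon1997, Thm. 6.3 (3) and Corollary] -/
theorem AbelianVariety.isDivisorGenerated_powSucc_of_ribetTypeTwentySixtyThree (A : AbelianVariety ℂ) (φ : A ⟶ A)
    {d : ℕ} (hd : 0 < d) (hφ : φ ≫ φ = -(d • 𝟙 A)) (hE2 : Module.finrank ℚ A.endAlgebra = 2)
    (h20 : eigenMultiplicity A φ (Complex.I * (Real.sqrt d : ℂ)) = 20)
    (h63 : eigenMultiplicity A φ (-(Complex.I * (Real.sqrt d : ℂ))) = 63) (N : ℕ) :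
    IsDivisorGenerated (A.powSucc N) := by
  refine AbelianVariety.isDivisorGenerated_powSucc_of_ribetType_ofCoreSmul A φ hd hφ hE2 (by omega) (by omega) ?_ N
  intro W' _ _ _ 𝔊 ι P' Q' s hbr hirr hι hιι hP' hQ' hfinP' hfinQ' hadd hsmul hsymm hPQ hdefP hdefQ hadj
  exact UnitaryTwentySixtyThree.eq_top_of_smul hbr hirr hι hιι hP' hQ' (by rw [hfinP', h20]) (by rw [hfinQ', h63]) hadd
    hsmul hsymm hPQ hdefP hdefQ hadj

/-- The mirror: `n_{i√d}(φ) = 63`, `n_{−i√d}(φ) = 20` (core `UnitaryTwentySixtyThree.eq_top_of_smul'`).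
[cite: Ribet1983, Thm. 0 and Thm. 3] [cite: Gordon1997, Thm. 6.3 (3) and Corollary] -/
theorem AbelianVariety.isDivisorGenerated_powSucc_of_ribetTypeTwentySixtyThree' (A : AbelianVariety ℂ) (φ : A ⟶ A)
    {d : ℕ} (hd : 0 < d) (hφ : φ ≫ φ = -(d • 𝟙 A)) (hE2 : Module.finrank ℚ A.endAlgebra = 2)
    (h63 : eigenMultiplicity A φ (Complex.I * (Real.sqrt d : ℂ)) = 63)
    (h20 : eigenMultiplicity A φ (-(Complex.I * (Real.sqrt d : ℂ))) = 20) (N : ℕ) :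
    IsDivisorGenerated (A.powSucc N) := by
  refine AbelianVariety.isDivisorGenerated_powSucc_of_ribetType_ofCoreSmul A φ hd hφ hE2 (by omega) (by omega) ?_ N
  intro W' _ _ _ 𝔊 ι P' Q' s hbr hirr hι hιι hP' hQ' hfinP' hfinQ' hadd hsmul hsymm hPQ hdefP hdefQ hadj
  exact UnitaryTwentySixtyThree.eq_top_of_smul' hbr hirr hι hιι hP' hQ' (by rw [hfinP', h63]) (by rw [hfinQ', h20])
    hadd hsmul hsymm hPQ hdefP hdefQ hadj

/-- **The Hodge conjecture for all powers `A^{N+1}` of an abelian variety of Ribet type `(20, 63)` — UNCONDITIONAL.**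
[cite: Ribet1983, Thm. 3] [cite: Deligne2000, §1] -/
theorem hodgeConjectureFor_powSucc_of_ribetTypeTwentySixtyThree (A : AbelianVariety ℂ) (φ : A ⟶ A)
    {d : ℕ} (hd : 0 < d) (hφ : φ ≫ φ = -(d • 𝟙 A)) (hE2 : Module.finrank ℚ A.endAlgebra = 2)
    (h20 : eigenMultiplicity A φ (Complex.I * (Real.sqrt d : ℂ)) = 20)
    (h63 : eigenMultiplicity A φ (-(Complex.I * (Real.sqrt d : ℂ))) = 63) (N : ℕ) :
    HodgeConjectureFor (A.powSucc N).dim (A.powSucc N).X :=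
  hodgeConjectureFor_of_isDivisorGenerated _
    (AbelianVariety.isDivisorGenerated_powSucc_of_ribetTypeTwentySixtyThree A φ hd hφ hE2 h20 h63 N)

/-- **83-FOLDS of signature `{20, 63}`: `B• = D•` on all powers — UNCONDITIONAL** (either eigenvalue may carry the `20`).
[cite: Ribet1983, Thm. 0 and Thm. 3] [cite: MoonenZarhin1999LowDim, §2 (2.4)] -/
theorem AbelianVariety.isDivisorGenerated_powSucc_of_eightythreefold_twentySixtyThree (A : AbelianVariety ℂ)
    (φ : A ⟶ A) {d : ℕ} (hd : 0 < d) (hφ : φ ≫ φ = -(d • 𝟙 A)) (hE2 : Module.finrank ℚ A.endAlgebra = 2)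
    (hX : A.dim = 83)
    (h20 : eigenMultiplicity A φ (Complex.I * (Real.sqrt d : ℂ)) = 20 ∨
      eigenMultiplicity A φ (-(Complex.I * (Real.sqrt d : ℂ))) = 20)
    (N : ℕ) : IsDivisorGenerated (A.powSucc N) := by
  have hsum := eigenMultiplicity_add_eigenMultiplicity_neg_eq_dim A φ hd hφ
  rw [hX] at hsum
  rcases h20 with h | h
  · exact AbelianVariety.isDivisorGenerated_powSucc_of_ribetTypeTwentySixtyThree A φ hd hφ hE2 h (by omega) N
  · exact AbelianVariety.isDivisorGenerated_powSucc_of_ribetTypeTwentySixtyThree' A φ hd hφ hE2 (by omega) h N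

/-- **The Hodge conjecture for all powers of a 83-FOLD of signature `{20, 63}` — UNCONDITIONAL.**
[cite: Ribet1983, Thm. 3] [cite: Deligne2000, §1] -/
theorem hodgeConjectureFor_powSucc_of_eightythreefold_twentySixtyThree (A : AbelianVariety ℂ)
    (φ : A ⟶ A) {d : ℕ} (hd : 0 < d) (hφ : φ ≫ φ = -(d • 𝟙 A)) (hE2 : Module.finrank ℚ A.endAlgebra = 2)
    (hX : A.dim = 83)
    (h20 : eigenMultiplicity A φ (Complex.I * (Real.sqrt d : ℂ)) = 20 ∨
      eigenMultiplicity A φ (-(Complex.I * (Real.sqrt d : ℂ))) = 20)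
    (N : ℕ) : HodgeConjectureFor (A.powSucc N).dim (A.powSucc N).X :=
  hodgeConjectureFor_of_isDivisorGenerated _
    (AbelianVariety.isDivisorGenerated_powSucc_of_eightythreefold_twentySixtyThree A φ hd hφ hE2 hX h20 N)

/-- **Ribet 1983 Thm. 3 at `(n′, n″) = (21, 62)` — UNCONDITIONAL** (core `UnitaryTwentyOneSixtyTwo.eq_top_of_smul`).
[cite: Ribet1983, Thm. 0 and Thm. 3] [cite: Gordon1997, Thm. 6.3 (3) and Corollary] -/
theorem AbelianVariety.isDivisorGenerated_powSucc_of_ribetTypeTwentyOneSixtyTwo (A : AbelianVariety ℂ) (φ : A ⟶ A)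
    {d : ℕ} (hd : 0 < d) (hφ : φ ≫ φ = -(d • 𝟙 A)) (hE2 : Module.finrank ℚ A.endAlgebra = 2)
    (h21 : eigenMultiplicity A φ (Complex.I * (Real.sqrt d : ℂ)) = 21)
    (h62 : eigenMultiplicity A φ (-(Complex.I * (Real.sqrt d : ℂ))) = 62) (N : ℕ) :
    IsDivisorGenerated (A.powSucc N) := by
  refine AbelianVariety.isDivisorGenerated_powSucc_of_ribetType_ofCoreSmul A φ hd hφ hE2 (by omega) (by omega) ?_ N
  intro W' _ _ _ 𝔊 ι P' Q' s hbr hirr hι hιι hP' hQ' hfinP' hfinQ' hadd hsmul hsymm hPQ hdefP hdefQ hadj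
  exact UnitaryTwentyOneSixtyTwo.eq_top_of_smul hbr hirr hι hιι hP' hQ' (by rw [hfinP', h21]) (by rw [hfinQ', h62]) hadd
    hsmul hsymm hPQ hdefP hdefQ hadj

/-- The mirror: `n_{i√d}(φ) = 62`, `n_{−i√d}(φ) = 21` (core `UnitaryTwentyOneSixtyTwo.eq_top_of_smul'`).
[cite: Ribet1983, Thm. 0 and Thm. 3] [cite: Gordon1997, Thm. 6.3 (3) and Corollary] -/
theorem AbelianVariety.isDivisorGenerated_powSucc_of_ribetTypeTwentyOneSixtyTwo' (A : AbelianVariety ℂ) (φ : A ⟶ A)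
    {d : ℕ} (hd : 0 < d) (hφ : φ ≫ φ = -(d • 𝟙 A)) (hE2 : Module.finrank ℚ A.endAlgebra = 2)
    (h62 : eigenMultiplicity A φ (Complex.I * (Real.sqrt d : ℂ)) = 62)
    (h21 : eigenMultiplicity A φ (-(Complex.I * (Real.sqrt d : ℂ))) = 21) (N : ℕ) :
    IsDivisorGenerated (A.powSucc N) := by
  refine AbelianVariety.isDivisorGenerated_powSucc_of_ribetType_ofCoreSmul A φ hd hφ hE2 (by omega) (by omega) ?_ N
  intro W' _ _ _ 𝔊 ι P' Q' s hbr hirr hι hιι hP' hQ' hfinP' hfinQ' hadd hsmul hsymm hPQ hdefP hdefQ hadj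
  exact UnitaryTwentyOneSixtyTwo.eq_top_of_smul' hbr hirr hι hιι hP' hQ' (by rw [hfinP', h62]) (by rw [hfinQ', h21])
    hadd hsmul hsymm hPQ hdefP hdefQ hadj

/-- **The Hodge conjecture for all powers `A^{N+1}` of an abelian variety of Ribet type `(21, 62)` — UNCONDITIONAL.**
[cite: Ribet1983, Thm. 3] [cite: Deligne2000, §1] -/
theorem hodgeConjectureFor_powSucc_of_ribetTypeTwentyOneSixtyTwo (A : AbelianVariety ℂ) (φ : A ⟶ A)
    {d : ℕ} (hd : 0 < d) (hφ : φ ≫ φ = -(d • 𝟙 A)) (hE2 : Module.finrank ℚ A.endAlgebra = 2)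
    (h21 : eigenMultiplicity A φ (Complex.I * (Real.sqrt d : ℂ)) = 21)
    (h62 : eigenMultiplicity A φ (-(Complex.I * (Real.sqrt d : ℂ))) = 62) (N : ℕ) :
    HodgeConjectureFor (A.powSucc N).dim (A.powSucc N).X :=
  hodgeConjectureFor_of_isDivisorGenerated _
    (AbelianVariety.isDivisorGenerated_powSucc_of_ribetTypeTwentyOneSixtyTwo A φ hd hφ hE2 h21 h62 N)

/-- **83-FOLDS of signature `{21, 62}`: `B• = D•` on all powers — UNCONDITIONAL** (either eigenvalue may carry the `21`).
[cite: Ribet1983, Thm. 0 and Thm. 3] [cite: MoonenZarhin1999LowDim, §2 (2.4)] -/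
theorem AbelianVariety.isDivisorGenerated_powSucc_of_eightythreefold_twentyOneSixtyTwo (A : AbelianVariety ℂ)
    (φ : A ⟶ A) {d : ℕ} (hd : 0 < d) (hφ : φ ≫ φ = -(d • 𝟙 A)) (hE2 : Module.finrank ℚ A.endAlgebra = 2)
    (hX : A.dim = 83)
    (h21 : eigenMultiplicity A φ (Complex.I * (Real.sqrt d : ℂ)) = 21 ∨
      eigenMultiplicity A φ (-(Complex.I * (Real.sqrt d : ℂ))) = 21)
    (N : ℕ) : IsDivisorGenerated (A.powSucc N) := by
  have hsum := eigenMultiplicity_add_eigenMultiplicity_neg_eq_dim A φ hd hφ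
  rw [hX] at hsum
  rcases h21 with h | h
  · exact AbelianVariety.isDivisorGenerated_powSucc_of_ribetTypeTwentyOneSixtyTwo A φ hd hφ hE2 h (by omega) N
  · exact AbelianVariety.isDivisorGenerated_powSucc_of_ribetTypeTwentyOneSixtyTwo' A φ hd hφ hE2 (by omega) h N

/-- **The Hodge conjecture for all powers of a 83-FOLD of signature `{21, 62}` — UNCONDITIONAL.**
[cite: Ribet1983, Thm. 3] [cite: Deligne2000, §1] -/
theorem hodgeConjectureFor_powSucc_of_eightythreefold_twentyOneSixtyTwo (A : AbelianVariety ℂ)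
    (φ : A ⟶ A) {d : ℕ} (hd : 0 < d) (hφ : φ ≫ φ = -(d • 𝟙 A)) (hE2 : Module.finrank ℚ A.endAlgebra = 2)
    (hX : A.dim = 83)
    (h21 : eigenMultiplicity A φ (Complex.I * (Real.sqrt d : ℂ)) = 21 ∨
      eigenMultiplicity A φ (-(Complex.I * (Real.sqrt d : ℂ))) = 21)
    (N : ℕ) : HodgeConjectureFor (A.powSucc N).dim (A.powSucc N).X :=
  hodgeConjectureFor_of_isDivisorGenerated _
    (AbelianVariety.isDivisorGenerated_powSucc_of_eightythreefold_twentyOneSixtyTwo A φ hd hφ hE2 hX h21 N)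

/-- **Ribet 1983 Thm. 3 at `(n′, n″) = (23, 60)` — UNCONDITIONAL** (core `UnitaryTwentyThreeSixty.eq_top_of_smul`).
[cite: Ribet1983, Thm. 0 and Thm. 3] [cite: Gordon1997, Thm. 6.3 (3) and Corollary] -/
theorem AbelianVariety.isDivisorGenerated_powSucc_of_ribetTypeTwentyThreeSixty (A : AbelianVariety ℂ) (φ : A ⟶ A)
    {d : ℕ} (hd : 0 < d) (hφ : φ ≫ φ = -(d • 𝟙 A)) (hE2 : Module.finrank ℚ A.endAlgebra = 2)
    (h23 : eigenMultiplicity A φ (Complex.I * (Real.sqrt d : ℂ)) = 23)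
    (h60 : eigenMultiplicity A φ (-(Complex.I * (Real.sqrt d : ℂ))) = 60) (N : ℕ) :
    IsDivisorGenerated (A.powSucc N) := by
  refine AbelianVariety.isDivisorGenerated_powSucc_of_ribetType_ofCoreSmul A φ hd hφ hE2 (by omega) (by omega) ?_ N
  intro W' _ _ _ 𝔊 ι P' Q' s hbr hirr hι hιι hP' hQ' hfinP' hfinQ' hadd hsmul hsymm hPQ hdefP hdefQ hadj
  exact UnitaryTwentyThreeSixty.eq_top_of_smul hbr hirr hι hιι hP' hQ' (by rw [hfinP', h23]) (by rw [hfinQ', h60]) hadd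
    hsmul hsymm hPQ hdefP hdefQ hadj

/-- The mirror: `n_{i√d}(φ) = 60`, `n_{−i√d}(φ) = 23` (core `UnitaryTwentyThreeSixty.eq_top_of_smul'`).
[cite: Ribet1983, Thm. 0 and Thm. 3] [cite: Gordon1997, Thm. 6.3 (3) and Corollary] -/
theorem AbelianVariety.isDivisorGenerated_powSucc_of_ribetTypeTwentyThreeSixty' (A : AbelianVariety ℂ) (φ : A ⟶ A)
    {d : ℕ} (hd : 0 < d) (hφ : φ ≫ φ = -(d • 𝟙 A)) (hE2 : Module.finrank ℚ A.endAlgebra = 2)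
    (h60 : eigenMultiplicity A φ (Complex.I * (Real.sqrt d : ℂ)) = 60)
    (h23 : eigenMultiplicity A φ (-(Complex.I * (Real.sqrt d : ℂ))) = 23) (N : ℕ) :
    IsDivisorGenerated (A.powSucc N) := by
  refine AbelianVariety.isDivisorGenerated_powSucc_of_ribetType_ofCoreSmul A φ hd hφ hE2 (by omega) (by omega) ?_ N
  intro W' _ _ _ 𝔊 ι P' Q' s hbr hirr hι hιι hP' hQ' hfinP' hfinQ' hadd hsmul hsymm hPQ hdefP hdefQ hadj
  exact UnitaryTwentyThreeSixty.eq_top_of_smul' hbr hirr hι hιι hP' hQ' (by rw [hfinP', h60]) (by rw [hfinQ', h23])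
    hadd hsmul hsymm hPQ hdefP hdefQ hadj

/-- **The Hodge conjecture for all powers `A^{N+1}` of an abelian variety of Ribet type `(23, 60)` — UNCONDITIONAL.**
[cite: Ribet1983, Thm. 3] [cite: Deligne2000, §1] -/
theorem hodgeConjectureFor_powSucc_of_ribetTypeTwentyThreeSixty (A : AbelianVariety ℂ) (φ : A ⟶ A)
    {d : ℕ} (hd : 0 < d) (hφ : φ ≫ φ = -(d • 𝟙 A)) (hE2 : Module.finrank ℚ A.endAlgebra = 2)
    (h23 : eigenMultiplicity A φ (Complex.I * (Real.sqrt d : ℂ)) = 23)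
    (h60 : eigenMultiplicity A φ (-(Complex.I * (Real.sqrt d : ℂ))) = 60) (N : ℕ) :
    HodgeConjectureFor (A.powSucc N).dim (A.powSucc N).X :=
  hodgeConjectureFor_of_isDivisorGenerated _
    (AbelianVariety.isDivisorGenerated_powSucc_of_ribetTypeTwentyThreeSixty A φ hd hφ hE2 h23 h60 N)

/-- **83-FOLDS of signature `{23, 60}`: `B• = D•` on all powers — UNCONDITIONAL** (either eigenvalue may carry the `23`).
[cite: Ribet1983, Thm. 0 and Thm. 3] [cite: MoonenZarhin1999LowDim, §2 (2.4)] -/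
theorem AbelianVariety.isDivisorGenerated_powSucc_of_eightythreefold_twentyThreeSixty (A : AbelianVariety ℂ)
    (φ : A ⟶ A) {d : ℕ} (hd : 0 < d) (hφ : φ ≫ φ = -(d • 𝟙 A)) (hE2 : Module.finrank ℚ A.endAlgebra = 2)
    (hX : A.dim = 83)
    (h23 : eigenMultiplicity A φ (Complex.I * (Real.sqrt d : ℂ)) = 23 ∨
      eigenMultiplicity A φ (-(Complex.I * (Real.sqrt d : ℂ))) = 23)
    (N : ℕ) : IsDivisorGenerated (A.powSucc N) := by
  have hsum := eigenMultiplicity_add_eigenMultiplicity_neg_eq_dim A φ hd hφ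
  rw [hX] at hsum
  rcases h23 with h | h
  · exact AbelianVariety.isDivisorGenerated_powSucc_of_ribetTypeTwentyThreeSixty A φ hd hφ hE2 h (by omega) N
  · exact AbelianVariety.isDivisorGenerated_powSucc_of_ribetTypeTwentyThreeSixty' A φ hd hφ hE2 (by omega) h N

/-- **The Hodge conjecture for all powers of a 83-FOLD of signature `{23, 60}` — UNCONDITIONAL.**
[cite: Ribet1983, Thm. 3] [cite: Deligne2000, §1] -/
theorem hodgeConjectureFor_powSucc_of_eightythreefold_twentyThreeSixty (A : AbelianVariety ℂ)
    (φ : A ⟶ A) {d : ℕ} (hd : 0 < d) (hφ : φ ≫ φ = -(d • 𝟙 A)) (hE2 : Module.finrank ℚ A.endAlgebra = 2)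
    (hX : A.dim = 83)
    (h23 : eigenMultiplicity A φ (Complex.I * (Real.sqrt d : ℂ)) = 23 ∨
      eigenMultiplicity A φ (-(Complex.I * (Real.sqrt d : ℂ))) = 23)
    (N : ℕ) : HodgeConjectureFor (A.powSucc N).dim (A.powSucc N).X :=
  hodgeConjectureFor_of_isDivisorGenerated _
    (AbelianVariety.isDivisorGenerated_powSucc_of_eightythreefold_twentyThreeSixty A φ hd hφ hE2 hX h23 N)

/-- **Ribet 1983 Thm. 3 at `(n′, n″) = (25, 58)` — UNCONDITIONAL** (core `UnitaryTwentyFiveFiftyEight.eq_top_of_smul`).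
[cite: Ribet1983, Thm. 0 and Thm. 3] [cite: Gordon1997, Thm. 6.3 (3) and Corollary] -/
theorem AbelianVariety.isDivisorGenerated_powSucc_of_ribetTypeTwentyFiveFiftyEight (A : AbelianVariety ℂ) (φ : A ⟶ A)
    {d : ℕ} (hd : 0 < d) (hφ : φ ≫ φ = -(d • 𝟙 A)) (hE2 : Module.finrank ℚ A.endAlgebra = 2)
    (h25 : eigenMultiplicity A φ (Complex.I * (Real.sqrt d : ℂ)) = 25)
    (h58 : eigenMultiplicity A φ (-(Complex.I * (Real.sqrt d : ℂ))) = 58) (N : ℕ) :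
    IsDivisorGenerated (A.powSucc N) := by
  refine AbelianVariety.isDivisorGenerated_powSucc_of_ribetType_ofCoreSmul A φ hd hφ hE2 (by omega) (by omega) ?_ N
  intro W' _ _ _ 𝔊 ι P' Q' s hbr hirr hι hιι hP' hQ' hfinP' hfinQ' hadd hsmul hsymm hPQ hdefP hdefQ hadj
  exact UnitaryTwentyFiveFiftyEight.eq_top_of_smul hbr hirr hι hιι hP' hQ' (by rw [hfinP', h25]) (by rw [hfinQ', h58]) hadd
    hsmul hsymm hPQ hdefP hdefQ hadj

/-- The mirror: `n_{i√d}(φ) = 58`, `n_{−i√d}(φ) = 25` (core `UnitaryTwentyFiveFiftyEight.eq_top_of_smul'`).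
[cite: Ribet1983, Thm. 0 and Thm. 3] [cite: Gordon1997, Thm. 6.3 (3) and Corollary] -/
theorem AbelianVariety.isDivisorGenerated_powSucc_of_ribetTypeTwentyFiveFiftyEight' (A : AbelianVariety ℂ) (φ : A ⟶ A)
    {d : ℕ} (hd : 0 < d) (hφ : φ ≫ φ = -(d • 𝟙 A)) (hE2 : Module.finrank ℚ A.endAlgebra = 2)
    (h58 : eigenMultiplicity A φ (Complex.I * (Real.sqrt d : ℂ)) = 58)
    (h25 : eigenMultiplicity A φ (-(Complex.I * (Real.sqrt d : ℂ))) = 25) (N : ℕ) :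
    IsDivisorGenerated (A.powSucc N) := by
  refine AbelianVariety.isDivisorGenerated_powSucc_of_ribetType_ofCoreSmul A φ hd hφ hE2 (by omega) (by omega) ?_ N
  intro W' _ _ _ 𝔊 ι P' Q' s hbr hirr hι hιι hP' hQ' hfinP' hfinQ' hadd hsmul hsymm hPQ hdefP hdefQ hadj
  exact UnitaryTwentyFiveFiftyEight.eq_top_of_smul' hbr hirr hι hιι hP' hQ' (by rw [hfinP', h58]) (by rw [hfinQ', h25])
    hadd hsmul hsymm hPQ hdefP hdefQ hadj

/-- **The Hodge conjecture for all powers `A^{N+1}` of an abelian variety of Ribet type `(25, 58)` — UNCONDITIONAL.**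
[cite: Ribet1983, Thm. 3] [cite: Deligne2000, §1] -/
theorem hodgeConjectureFor_powSucc_of_ribetTypeTwentyFiveFiftyEight (A : AbelianVariety ℂ) (φ : A ⟶ A)
    {d : ℕ} (hd : 0 < d) (hφ : φ ≫ φ = -(d • 𝟙 A)) (hE2 : Module.finrank ℚ A.endAlgebra = 2)
    (h25 : eigenMultiplicity A φ (Complex.I * (Real.sqrt d : ℂ)) = 25)
    (h58 : eigenMultiplicity A φ (-(Complex.I * (Real.sqrt d : ℂ))) = 58) (N : ℕ) :
    HodgeConjectureFor (A.powSucc N).dim (A.powSucc N).X :=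
  hodgeConjectureFor_of_isDivisorGenerated _
    (AbelianVariety.isDivisorGenerated_powSucc_of_ribetTypeTwentyFiveFiftyEight A φ hd hφ hE2 h25 h58 N)

/-- **83-FOLDS of signature `{25, 58}`: `B• = D•` on all powers — UNCONDITIONAL** (either eigenvalue may carry the `25`).
[cite: Ribet1983, Thm. 0 and Thm. 3] [cite: MoonenZarhin1999LowDim, §2 (2.4)] -/
theorem AbelianVariety.isDivisorGenerated_powSucc_of_eightythreefold_twentyFiveFiftyEight (A : AbelianVariety ℂ)
    (φ : A ⟶ A) {d : ℕ} (hd : 0 < d) (hφ : φ ≫ φ = -(d • 𝟙 A)) (hE2 : Module.finrank ℚ A.endAlgebra = 2)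
    (hX : A.dim = 83)
    (h25 : eigenMultiplicity A φ (Complex.I * (Real.sqrt d : ℂ)) = 25 ∨
      eigenMultiplicity A φ (-(Complex.I * (Real.sqrt d : ℂ))) = 25)
    (N : ℕ) : IsDivisorGenerated (A.powSucc N) := by
  have hsum := eigenMultiplicity_add_eigenMultiplicity_neg_eq_dim A φ hd hφ
  rw [hX] at hsum
  rcases h25 with h | h
  · exact AbelianVariety.isDivisorGenerated_powSucc_of_ribetTypeTwentyFiveFiftyEight A φ hd hφ hE2 h (by omega) N
  · exact AbelianVariety.isDivisorGenerated_powSucc_of_ribetTypeTwentyFiveFiftyEight' A φ hd hφ hE2 (by omega) h N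

/-- **The Hodge conjecture for all powers of a 83-FOLD of signature `{25, 58}` — UNCONDITIONAL.**
[cite: Ribet1983, Thm. 3] [cite: Deligne2000, §1] -/
theorem hodgeConjectureFor_powSucc_of_eightythreefold_twentyFiveFiftyEight (A : AbelianVariety ℂ)
    (φ : A ⟶ A) {d : ℕ} (hd : 0 < d) (hφ : φ ≫ φ = -(d • 𝟙 A)) (hE2 : Module.finrank ℚ A.endAlgebra = 2)
    (hX : A.dim = 83)
    (h25 : eigenMultiplicity A φ (Complex.I * (Real.sqrt d : ℂ)) = 25 ∨
      eigenMultiplicity A φ (-(Complex.I * (Real.sqrt d : ℂ))) = 25)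
    (N : ℕ) : HodgeConjectureFor (A.powSucc N).dim (A.powSucc N).X :=
  hodgeConjectureFor_of_isDivisorGenerated _
    (AbelianVariety.isDivisorGenerated_powSucc_of_eightythreefold_twentyFiveFiftyEight A φ hd hφ hE2 hX h25 N)

/-- **Ribet 1983 Thm. 3 at `(n′, n″) = (26, 57)` — UNCONDITIONAL** (core `UnitaryTwentySixFiftySeven.eq_top_of_smul`).
[cite: Ribet1983, Thm. 0 and Thm. 3] [cite: Gordon1997, Thm. 6.3 (3) and Corollary] -/
theorem AbelianVariety.isDivisorGenerated_powSucc_of_ribetTypeTwentySixFiftySeven (A : AbelianVariety ℂ) (φ : A ⟶ A)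
    {d : ℕ} (hd : 0 < d) (hφ : φ ≫ φ = -(d • 𝟙 A)) (hE2 : Module.finrank ℚ A.endAlgebra = 2)
    (h26 : eigenMultiplicity A φ (Complex.I * (Real.sqrt d : ℂ)) = 26)
    (h57 : eigenMultiplicity A φ (-(Complex.I * (Real.sqrt d : ℂ))) = 57) (N : ℕ) :
    IsDivisorGenerated (A.powSucc N) := by
  refine AbelianVariety.isDivisorGenerated_powSucc_of_ribetType_ofCoreSmul A φ hd hφ hE2 (by omega) (by omega) ?_ N
  intro W' _ _ _ 𝔊 ι P' Q' s hbr hirr hι hιι hP' hQ' hfinP' hfinQ' hadd hsmul hsymm hPQ hdefP hdefQ hadj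
  exact UnitaryTwentySixFiftySeven.eq_top_of_smul hbr hirr hι hιι hP' hQ' (by rw [hfinP', h26]) (by rw [hfinQ', h57]) hadd
    hsmul hsymm hPQ hdefP hdefQ hadj

/-- The mirror: `n_{i√d}(φ) = 57`, `n_{−i√d}(φ) = 26` (core `UnitaryTwentySixFiftySeven.eq_top_of_smul'`).
[cite: Ribet1983, Thm. 0 and Thm. 3] [cite: Gordon1997, Thm. 6.3 (3) and Corollary] -/
theorem AbelianVariety.isDivisorGenerated_powSucc_of_ribetTypeTwentySixFiftySeven' (A : AbelianVariety ℂ) (φ : A ⟶ A)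
    {d : ℕ} (hd : 0 < d) (hφ : φ ≫ φ = -(d • 𝟙 A)) (hE2 : Module.finrank ℚ A.endAlgebra = 2)
    (h57 : eigenMultiplicity A φ (Complex.I * (Real.sqrt d : ℂ)) = 57)
    (h26 : eigenMultiplicity A φ (-(Complex.I * (Real.sqrt d : ℂ))) = 26) (N : ℕ) :
    IsDivisorGenerated (A.powSucc N) := by
  refine AbelianVariety.isDivisorGenerated_powSucc_of_ribetType_ofCoreSmul A φ hd hφ hE2 (by omega) (by omega) ?_ N
  intro W' _ _ _ 𝔊 ι P' Q' s hbr hirr hι hιι hP' hQ' hfinP' hfinQ' hadd hsmul hsymm hPQ hdefP hdefQ hadj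
  exact UnitaryTwentySixFiftySeven.eq_top_of_smul' hbr hirr hι hιι hP' hQ' (by rw [hfinP', h57]) (by rw [hfinQ', h26])
    hadd hsmul hsymm hPQ hdefP hdefQ hadj

/-- **The Hodge conjecture for all powers `A^{N+1}` of an abelian variety of Ribet type `(26, 57)` — UNCONDITIONAL.**
[cite: Ribet1983, Thm. 3] [cite: Deligne2000, §1] -/
theorem hodgeConjectureFor_powSucc_of_ribetTypeTwentySixFiftySeven (A : AbelianVariety ℂ) (φ : A ⟶ A)
    {d : ℕ} (hd : 0 < d) (hφ : φ ≫ φ = -(d • 𝟙 A)) (hE2 : Module.finrank ℚ A.endAlgebra = 2)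
    (h26 : eigenMultiplicity A φ (Complex.I * (Real.sqrt d : ℂ)) = 26)
    (h57 : eigenMultiplicity A φ (-(Complex.I * (Real.sqrt d : ℂ))) = 57) (N : ℕ) :
    HodgeConjectureFor (A.powSucc N).dim (A.powSucc N).X :=
  hodgeConjectureFor_of_isDivisorGenerated _
    (AbelianVariety.isDivisorGenerated_powSucc_of_ribetTypeTwentySixFiftySeven A φ hd hφ hE2 h26 h57 N)

/-- **83-FOLDS of signature `{26, 57}`: `B• = D•` on all powers — UNCONDITIONAL** (either eigenvalue may carry the `26`).
[cite: Ribet1983, Thm. 0 and Thm. 3] [cite: MoonenZarhin1999LowDim, §2 (2.4)] -/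
theorem AbelianVariety.isDivisorGenerated_powSucc_of_eightythreefold_twentySixFiftySeven (A : AbelianVariety ℂ)
    (φ : A ⟶ A) {d : ℕ} (hd : 0 < d) (hφ : φ ≫ φ = -(d • 𝟙 A)) (hE2 : Module.finrank ℚ A.endAlgebra = 2)
    (hX : A.dim = 83)
    (h26 : eigenMultiplicity A φ (Complex.I * (Real.sqrt d : ℂ)) = 26 ∨
      eigenMultiplicity A φ (-(Complex.I * (Real.sqrt d : ℂ))) = 26)
    (N : ℕ) : IsDivisorGenerated (A.powSucc N) := by
  have hsum := eigenMultiplicity_add_eigenMultiplicity_neg_eq_dim A φ hd hφ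
  rw [hX] at hsum
  rcases h26 with h | h
  · exact AbelianVariety.isDivisorGenerated_powSucc_of_ribetTypeTwentySixFiftySeven A φ hd hφ hE2 h (by omega) N
  · exact AbelianVariety.isDivisorGenerated_powSucc_of_ribetTypeTwentySixFiftySeven' A φ hd hφ hE2 (by omega) h N

/-- **The Hodge conjecture for all powers of a 83-FOLD of signature `{26, 57}` — UNCONDITIONAL.**
[cite: Ribet1983, Thm. 3] [cite: Deligne2000, §1] -/
theorem hodgeConjectureFor_powSucc_of_eightythreefold_twentySixFiftySeven (A : AbelianVariety ℂ)
    (φ : A ⟶ A) {d : ℕ} (hd : 0 < d) (hφ : φ ≫ φ = -(d • 𝟙 A)) (hE2 : Module.finrank ℚ A.endAlgebra = 2)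
    (hX : A.dim = 83)
    (h26 : eigenMultiplicity A φ (Complex.I * (Real.sqrt d : ℂ)) = 26 ∨
      eigenMultiplicity A φ (-(Complex.I * (Real.sqrt d : ℂ))) = 26)
    (N : ℕ) : HodgeConjectureFor (A.powSucc N).dim (A.powSucc N).X :=
  hodgeConjectureFor_of_isDivisorGenerated _
    (AbelianVariety.isDivisorGenerated_powSucc_of_eightythreefold_twentySixFiftySeven A φ hd hφ hE2 hX h26 N)

/-- **Ribet 1983 Thm. 3 at `(n′, n″) = (27, 56)` — UNCONDITIONAL** (core `UnitaryTwentySevenFiftySix.eq_top_of_smul`).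
[cite: Ribet1983, Thm. 0 and Thm. 3] [cite: Gordon1997, Thm. 6.3 (3) and Corollary] -/
theorem AbelianVariety.isDivisorGenerated_powSucc_of_ribetTypeTwentySevenFiftySix (A : AbelianVariety ℂ) (φ : A ⟶ A)
    {d : ℕ} (hd : 0 < d) (hφ : φ ≫ φ = -(d • 𝟙 A)) (hE2 : Module.finrank ℚ A.endAlgebra = 2)
    (h27 : eigenMultiplicity A φ (Complex.I * (Real.sqrt d : ℂ)) = 27)
    (h56 : eigenMultiplicity A φ (-(Complex.I * (Real.sqrt d : ℂ))) = 56) (N : ℕ) :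
    IsDivisorGenerated (A.powSucc N) := by
  refine AbelianVariety.isDivisorGenerated_powSucc_of_ribetType_ofCoreSmul A φ hd hφ hE2 (by omega) (by omega) ?_ N
  intro W' _ _ _ 𝔊 ι P' Q' s hbr hirr hι hιι hP' hQ' hfinP' hfinQ' hadd hsmul hsymm hPQ hdefP hdefQ hadj
  exact UnitaryTwentySevenFiftySix.eq_top_of_smul hbr hirr hι hιι hP' hQ' (by rw [hfinP', h27]) (by rw [hfinQ', h56]) hadd
    hsmul hsymm hPQ hdefP hdefQ hadj

/-- The mirror: `n_{i√d}(φ) = 56`, `n_{−i√d}(φ) = 27` (core `UnitaryTwentySevenFiftySix.eq_top_of_smul'`).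
[cite: Ribet1983, Thm. 0 and Thm. 3] [cite: Gordon1997, Thm. 6.3 (3) and Corollary] -/
theorem AbelianVariety.isDivisorGenerated_powSucc_of_ribetTypeTwentySevenFiftySix' (A : AbelianVariety ℂ) (φ : A ⟶ A)
    {d : ℕ} (hd : 0 < d) (hφ : φ ≫ φ = -(d • 𝟙 A)) (hE2 : Module.finrank ℚ A.endAlgebra = 2)
    (h56 : eigenMultiplicity A φ (Complex.I * (Real.sqrt d : ℂ)) = 56)
    (h27 : eigenMultiplicity A φ (-(Complex.I * (Real.sqrt d : ℂ))) = 27) (N : ℕ) :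
    IsDivisorGenerated (A.powSucc N) := by
  refine AbelianVariety.isDivisorGenerated_powSucc_of_ribetType_ofCoreSmul A φ hd hφ hE2 (by omega) (by omega) ?_ N
  intro W' _ _ _ 𝔊 ι P' Q' s hbr hirr hι hιι hP' hQ' hfinP' hfinQ' hadd hsmul hsymm hPQ hdefP hdefQ hadj
  exact UnitaryTwentySevenFiftySix.eq_top_of_smul' hbr hirr hι hιι hP' hQ' (by rw [hfinP', h56]) (by rw [hfinQ', h27])
    hadd hsmul hsymm hPQ hdefP hdefQ hadj

/-- **The Hodge conjecture for all powers `A^{N+1}` of an abelian variety of Ribet type `(27, 56)` — UNCONDITIONAL.**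
[cite: Ribet1983, Thm. 3] [cite: Deligne2000, §1] -/
theorem hodgeConjectureFor_powSucc_of_ribetTypeTwentySevenFiftySix (A : AbelianVariety ℂ) (φ : A ⟶ A)
    {d : ℕ} (hd : 0 < d) (hφ : φ ≫ φ = -(d • 𝟙 A)) (hE2 : Module.finrank ℚ A.endAlgebra = 2)
    (h27 : eigenMultiplicity A φ (Complex.I * (Real.sqrt d : ℂ)) = 27)
    (h56 : eigenMultiplicity A φ (-(Complex.I * (Real.sqrt d : ℂ))) = 56) (N : ℕ) :
    HodgeConjectureFor (A.powSucc N).dim (A.powSucc N).X :=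
  hodgeConjectureFor_of_isDivisorGenerated _
    (AbelianVariety.isDivisorGenerated_powSucc_of_ribetTypeTwentySevenFiftySix A φ hd hφ hE2 h27 h56 N)

/-- **83-FOLDS of signature `{27, 56}`: `B• = D•` on all powers — UNCONDITIONAL** (either eigenvalue may carry the `27`).
[cite: Ribet1983, Thm. 0 and Thm. 3] [cite: MoonenZarhin1999LowDim, §2 (2.4)] -/
theorem AbelianVariety.isDivisorGenerated_powSucc_of_eightythreefold_twentySevenFiftySix (A : AbelianVariety ℂ)
    (φ : A ⟶ A) {d : ℕ} (hd : 0 < d) (hφ : φ ≫ φ = -(d • 𝟙 A)) (hE2 : Module.finrank ℚ A.endAlgebra = 2)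
    (hX : A.dim = 83)
    (h27 : eigenMultiplicity A φ (Complex.I * (Real.sqrt d : ℂ)) = 27 ∨
      eigenMultiplicity A φ (-(Complex.I * (Real.sqrt d : ℂ))) = 27)
    (N : ℕ) : IsDivisorGenerated (A.powSucc N) := by
  have hsum := eigenMultiplicity_add_eigenMultiplicity_neg_eq_dim A φ hd hφ
  rw [hX] at hsum
  rcases h27 with h | h
  · exact AbelianVariety.isDivisorGenerated_powSucc_of_ribetTypeTwentySevenFiftySix A φ hd hφ hE2 h (by omega) N
  · exact AbelianVariety.isDivisorGenerated_powSucc_of_ribetTypeTwentySevenFiftySix' A φ hd hφ hE2 (by omega) h N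

/-- **The Hodge conjecture for all powers of a 83-FOLD of signature `{27, 56}` — UNCONDITIONAL.**
[cite: Ribet1983, Thm. 3] [cite: Deligne2000, §1] -/
theorem hodgeConjectureFor_powSucc_of_eightythreefold_twentySevenFiftySix (A : AbelianVariety ℂ)
    (φ : A ⟶ A) {d : ℕ} (hd : 0 < d) (hφ : φ ≫ φ = -(d • 𝟙 A)) (hE2 : Module.finrank ℚ A.endAlgebra = 2)
    (hX : A.dim = 83)
    (h27 : eigenMultiplicity A φ (Complex.I * (Real.sqrt d : ℂ)) = 27 ∨
      eigenMultiplicity A φ (-(Complex.I * (Real.sqrt d : ℂ))) = 27)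
    (N : ℕ) : HodgeConjectureFor (A.powSucc N).dim (A.powSucc N).X :=
  hodgeConjectureFor_of_isDivisorGenerated _
    (AbelianVariety.isDivisorGenerated_powSucc_of_eightythreefold_twentySevenFiftySix A φ hd hφ hE2 hX h27 N)

/-- **Ribet 1983 Thm. 3 at `(n′, n″) = (28, 55)` — UNCONDITIONAL** (core `UnitaryTwentyEightFiftyFive.eq_top_of_smul`).
[cite: Ribet1983, Thm. 0 and Thm. 3] [cite: Gordon1997, Thm. 6.3 (3) and Corollary] -/
theorem AbelianVariety.isDivisorGenerated_powSucc_of_ribetTypeTwentyEightFiftyFive (A : AbelianVariety ℂ) (φ : A ⟶ A)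
    {d : ℕ} (hd : 0 < d) (hφ : φ ≫ φ = -(d • 𝟙 A)) (hE2 : Module.finrank ℚ A.endAlgebra = 2)
    (h28 : eigenMultiplicity A φ (Complex.I * (Real.sqrt d : ℂ)) = 28)
    (h55 : eigenMultiplicity A φ (-(Complex.I * (Real.sqrt d : ℂ))) = 55) (N : ℕ) :
    IsDivisorGenerated (A.powSucc N) := by
  refine AbelianVariety.isDivisorGenerated_powSucc_of_ribetType_ofCoreSmul A φ hd hφ hE2 (by omega) (by omega) ?_ N
  intro W' _ _ _ 𝔊 ι P' Q' s hbr hirr hι hιι hP' hQ' hfinP' hfinQ' hadd hsmul hsymm hPQ hdefP hdefQ hadj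
  exact UnitaryTwentyEightFiftyFive.eq_top_of_smul hbr hirr hι hιι hP' hQ' (by rw [hfinP', h28]) (by rw [hfinQ', h55]) hadd
    hsmul hsymm hPQ hdefP hdefQ hadj

/-- The mirror: `n_{i√d}(φ) = 55`, `n_{−i√d}(φ) = 28` (core `UnitaryTwentyEightFiftyFive.eq_top_of_smul'`).
[cite: Ribet1983, Thm. 0 and Thm. 3] [cite: Gordon1997, Thm. 6.3 (3) and Corollary] -/
theorem AbelianVariety.isDivisorGenerated_powSucc_of_ribetTypeTwentyEightFiftyFive' (A : AbelianVariety ℂ) (φ : A ⟶ A)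
    {d : ℕ} (hd : 0 < d) (hφ : φ ≫ φ = -(d • 𝟙 A)) (hE2 : Module.finrank ℚ A.endAlgebra = 2)
    (h55 : eigenMultiplicity A φ (Complex.I * (Real.sqrt d : ℂ)) = 55)
    (h28 : eigenMultiplicity A φ (-(Complex.I * (Real.sqrt d : ℂ))) = 28) (N : ℕ) :
    IsDivisorGenerated (A.powSucc N) := by
  refine AbelianVariety.isDivisorGenerated_powSucc_of_ribetType_ofCoreSmul A φ hd hφ hE2 (by omega) (by omega) ?_ N
  intro W' _ _ _ 𝔊 ι P' Q' s hbr hirr hι hιι hP' hQ' hfinP' hfinQ' hadd hsmul hsymm hPQ hdefP hdefQ hadj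
  exact UnitaryTwentyEightFiftyFive.eq_top_of_smul' hbr hirr hι hιι hP' hQ' (by rw [hfinP', h55]) (by rw [hfinQ', h28])
    hadd hsmul hsymm hPQ hdefP hdefQ hadj

/-- **The Hodge conjecture for all powers `A^{N+1}` of an abelian variety of Ribet type `(28, 55)` — UNCONDITIONAL.**
[cite: Ribet1983, Thm. 3] [cite: Deligne2000, §1] -/
theorem hodgeConjectureFor_powSucc_of_ribetTypeTwentyEightFiftyFive (A : AbelianVariety ℂ) (φ : A ⟶ A)
    {d : ℕ} (hd : 0 < d) (hφ : φ ≫ φ = -(d • 𝟙 A)) (hE2 : Module.finrank ℚ A.endAlgebra = 2)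
    (h28 : eigenMultiplicity A φ (Complex.I * (Real.sqrt d : ℂ)) = 28)
    (h55 : eigenMultiplicity A φ (-(Complex.I * (Real.sqrt d : ℂ))) = 55) (N : ℕ) :
    HodgeConjectureFor (A.powSucc N).dim (A.powSucc N).X :=
  hodgeConjectureFor_of_isDivisorGenerated _
    (AbelianVariety.isDivisorGenerated_powSucc_of_ribetTypeTwentyEightFiftyFive A φ hd hφ hE2 h28 h55 N)

/-- **83-FOLDS of signature `{28, 55}`: `B• = D•` on all powers — UNCONDITIONAL** (either eigenvalue may carry the `28`).
[cite: Ribet1983, Thm. 0 and Thm. 3] [cite: MoonenZarhin1999LowDim, §2 (2.4)] -/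
theorem AbelianVariety.isDivisorGenerated_powSucc_of_eightythreefold_twentyEightFiftyFive (A : AbelianVariety ℂ)
    (φ : A ⟶ A) {d : ℕ} (hd : 0 < d) (hφ : φ ≫ φ = -(d • 𝟙 A)) (hE2 : Module.finrank ℚ A.endAlgebra = 2)
    (hX : A.dim = 83)
    (h28 : eigenMultiplicity A φ (Complex.I * (Real.sqrt d : ℂ)) = 28 ∨
      eigenMultiplicity A φ (-(Complex.I * (Real.sqrt d : ℂ))) = 28)
    (N : ℕ) : IsDivisorGenerated (A.powSucc N) := by
  have hsum := eigenMultiplicity_add_eigenMultiplicity_neg_eq_dim A φ hd hφ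
  rw [hX] at hsum
  rcases h28 with h | h
  · exact AbelianVariety.isDivisorGenerated_powSucc_of_ribetTypeTwentyEightFiftyFive A φ hd hφ hE2 h (by omega) N
  · exact AbelianVariety.isDivisorGenerated_powSucc_of_ribetTypeTwentyEightFiftyFive' A φ hd hφ hE2 (by omega) h N

/-- **The Hodge conjecture for all powers of a 83-FOLD of signature `{28, 55}` — UNCONDITIONAL.**
[cite: Ribet1983, Thm. 3] [cite: Deligne2000, §1] -/
theorem hodgeConjectureFor_powSucc_of_eightythreefold_twentyEightFiftyFive (A : AbelianVariety ℂ)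
    (φ : A ⟶ A) {d : ℕ} (hd : 0 < d) (hφ : φ ≫ φ = -(d • 𝟙 A)) (hE2 : Module.finrank ℚ A.endAlgebra = 2)
    (hX : A.dim = 83)
    (h28 : eigenMultiplicity A φ (Complex.I * (Real.sqrt d : ℂ)) = 28 ∨
      eigenMultiplicity A φ (-(Complex.I * (Real.sqrt d : ℂ))) = 28)
    (N : ℕ) : HodgeConjectureFor (A.powSucc N).dim (A.powSucc N).X :=
  hodgeConjectureFor_of_isDivisorGenerated _
    (AbelianVariety.isDivisorGenerated_powSucc_of_eightythreefold_twentyEightFiftyFive A φ hd hφ hE2 hX h28 N)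

/-- **Ribet 1983 Thm. 3 at `(n′, n″) = (29, 54)` — UNCONDITIONAL** (core `UnitaryTwentyNineFiftyFour.eq_top_of_smul`).
[cite: Ribet1983, Thm. 0 and Thm. 3] [cite: Gordon1997, Thm. 6.3 (3) and Corollary] -/
theorem AbelianVariety.isDivisorGenerated_powSucc_of_ribetTypeTwentyNineFiftyFour (A : AbelianVariety ℂ) (φ : A ⟶ A)
    {d : ℕ} (hd : 0 < d) (hφ : φ ≫ φ = -(d • 𝟙 A)) (hE2 : Module.finrank ℚ A.endAlgebra = 2)
    (h29 : eigenMultiplicity A φ (Complex.I * (Real.sqrt d : ℂ)) = 29)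
    (h54 : eigenMultiplicity A φ (-(Complex.I * (Real.sqrt d : ℂ))) = 54) (N : ℕ) :
    IsDivisorGenerated (A.powSucc N) := by
  refine AbelianVariety.isDivisorGenerated_powSucc_of_ribetType_ofCoreSmul A φ hd hφ hE2 (by omega) (by omega) ?_ N
  intro W' _ _ _ 𝔊 ι P' Q' s hbr hirr hι hιι hP' hQ' hfinP' hfinQ' hadd hsmul hsymm hPQ hdefP hdefQ hadj
  exact UnitaryTwentyNineFiftyFour.eq_top_of_smul hbr hirr hι hιι hP' hQ' (by rw [hfinP', h29]) (by rw [hfinQ', h54]) hadd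
    hsmul hsymm hPQ hdefP hdefQ hadj

/-- The mirror: `n_{i√d}(φ) = 54`, `n_{−i√d}(φ) = 29` (core `UnitaryTwentyNineFiftyFour.eq_top_of_smul'`).
[cite: Ribet1983, Thm. 0 and Thm. 3] [cite: Gordon1997, Thm. 6.3 (3) and Corollary] -/
theorem AbelianVariety.isDivisorGenerated_powSucc_of_ribetTypeTwentyNineFiftyFour' (A : AbelianVariety ℂ) (φ : A ⟶ A)
    {d : ℕ} (hd : 0 < d) (hφ : φ ≫ φ = -(d • 𝟙 A)) (hE2 : Module.finrank ℚ A.endAlgebra = 2)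
    (h54 : eigenMultiplicity A φ (Complex.I * (Real.sqrt d : ℂ)) = 54)
    (h29 : eigenMultiplicity A φ (-(Complex.I * (Real.sqrt d : ℂ))) = 29) (N : ℕ) :
    IsDivisorGenerated (A.powSucc N) := by
  refine AbelianVariety.isDivisorGenerated_powSucc_of_ribetType_ofCoreSmul A φ hd hφ hE2 (by omega) (by omega) ?_ N
  intro W' _ _ _ 𝔊 ι P' Q' s hbr hirr hι hιι hP' hQ' hfinP' hfinQ' hadd hsmul hsymm hPQ hdefP hdefQ hadj
  exact UnitaryTwentyNineFiftyFour.eq_top_of_smul' hbr hirr hι hιι hP' hQ' (by rw [hfinP', h54]) (by rw [hfinQ', h29])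
    hadd hsmul hsymm hPQ hdefP hdefQ hadj

/-- **The Hodge conjecture for all powers `A^{N+1}` of an abelian variety of Ribet type `(29, 54)` — UNCONDITIONAL.**
[cite: Ribet1983, Thm. 3] [cite: Deligne2000, §1] -/
theorem hodgeConjectureFor_powSucc_of_ribetTypeTwentyNineFiftyFour (A : AbelianVariety ℂ) (φ : A ⟶ A)
    {d : ℕ} (hd : 0 < d) (hφ : φ ≫ φ = -(d • 𝟙 A)) (hE2 : Module.finrank ℚ A.endAlgebra = 2)
    (h29 : eigenMultiplicity A φ (Complex.I * (Real.sqrt d : ℂ)) = 29)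
    (h54 : eigenMultiplicity A φ (-(Complex.I * (Real.sqrt d : ℂ))) = 54) (N : ℕ) :
    HodgeConjectureFor (A.powSucc N).dim (A.powSucc N).X :=
  hodgeConjectureFor_of_isDivisorGenerated _
    (AbelianVariety.isDivisorGenerated_powSucc_of_ribetTypeTwentyNineFiftyFour A φ hd hφ hE2 h29 h54 N)

/-- **83-FOLDS of signature `{29, 54}`: `B• = D•` on all powers — UNCONDITIONAL** (either eigenvalue may carry the `29`).
[cite: Ribet1983, Thm. 0 and Thm. 3] [cite: MoonenZarhin1999LowDim, §2 (2.4)] -/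
theorem AbelianVariety.isDivisorGenerated_powSucc_of_eightythreefold_twentyNineFiftyFour (A : AbelianVariety ℂ)
    (φ : A ⟶ A) {d : ℕ} (hd : 0 < d) (hφ : φ ≫ φ = -(d • 𝟙 A)) (hE2 : Module.finrank ℚ A.endAlgebra = 2)
    (hX : A.dim = 83)
    (h29 : eigenMultiplicity A φ (Complex.I * (Real.sqrt d : ℂ)) = 29 ∨
      eigenMultiplicity A φ (-(Complex.I * (Real.sqrt d : ℂ))) = 29)
    (N : ℕ) : IsDivisorGenerated (A.powSucc N) := by
  have hsum := eigenMultiplicity_add_eigenMultiplicity_neg_eq_dim A φ hd hφ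
  rw [hX] at hsum
  rcases h29 with h | h
  · exact AbelianVariety.isDivisorGenerated_powSucc_of_ribetTypeTwentyNineFiftyFour A φ hd hφ hE2 h (by omega) N
  · exact AbelianVariety.isDivisorGenerated_powSucc_of_ribetTypeTwentyNineFiftyFour' A φ hd hφ hE2 (by omega) h N

/-- **The Hodge conjecture for all powers of a 83-FOLD of signature `{29, 54}` — UNCONDITIONAL.**
[cite: Ribet1983, Thm. 3] [cite: Deligne2000, §1] -/
theorem hodgeConjectureFor_powSucc_of_eightythreefold_twentyNineFiftyFour (A : AbelianVariety ℂ)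
    (φ : A ⟶ A) {d : ℕ} (hd : 0 < d) (hφ : φ ≫ φ = -(d • 𝟙 A)) (hE2 : Module.finrank ℚ A.endAlgebra = 2)
    (hX : A.dim = 83)
    (h29 : eigenMultiplicity A φ (Complex.I * (Real.sqrt d : ℂ)) = 29 ∨
      eigenMultiplicity A φ (-(Complex.I * (Real.sqrt d : ℂ))) = 29)
    (N : ℕ) : HodgeConjectureFor (A.powSucc N).dim (A.powSucc N).X :=
  hodgeConjectureFor_of_isDivisorGenerated _
    (AbelianVariety.isDivisorGenerated_powSucc_of_eightythreefold_twentyNineFiftyFour A φ hd hφ hE2 hX h29 N)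

/-- **Ribet 1983 Thm. 3 at `(n′, n″) = (31, 52)` — UNCONDITIONAL** (core `UnitaryThirtyOneFiftyTwo.eq_top_of_smul`).
[cite: Ribet1983, Thm. 0 and Thm. 3] [cite: Gordon1997, Thm. 6.3 (3) and Corollary] -/
theorem AbelianVariety.isDivisorGenerated_powSucc_of_ribetTypeThirtyOneFiftyTwo (A : AbelianVariety ℂ) (φ : A ⟶ A)
    {d : ℕ} (hd : 0 < d) (hφ : φ ≫ φ = -(d • 𝟙 A)) (hE2 : Module.finrank ℚ A.endAlgebra = 2)
    (h31 : eigenMultiplicity A φ (Complex.I * (Real.sqrt d : ℂ)) = 31)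
    (h52 : eigenMultiplicity A φ (-(Complex.I * (Real.sqrt d : ℂ))) = 52) (N : ℕ) :
    IsDivisorGenerated (A.powSucc N) := by
  refine AbelianVariety.isDivisorGenerated_powSucc_of_ribetType_ofCoreSmul A φ hd hφ hE2 (by omega) (by omega) ?_ N
  intro W' _ _ _ 𝔊 ι P' Q' s hbr hirr hι hιι hP' hQ' hfinP' hfinQ' hadd hsmul hsymm hPQ hdefP hdefQ hadj
  exact UnitaryThirtyOneFiftyTwo.eq_top_of_smul hbr hirr hι hιι hP' hQ' (by rw [hfinP', h31]) (by rw [hfinQ', h52]) hadd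
    hsmul hsymm hPQ hdefP hdefQ hadj

/-- The mirror: `n_{i√d}(φ) = 52`, `n_{−i√d}(φ) = 31` (core `UnitaryThirtyOneFiftyTwo.eq_top_of_smul'`).
[cite: Ribet1983, Thm. 0 and Thm. 3] [cite: Gordon1997, Thm. 6.3 (3) and Corollary] -/
theorem AbelianVariety.isDivisorGenerated_powSucc_of_ribetTypeThirtyOneFiftyTwo' (A : AbelianVariety ℂ) (φ : A ⟶ A)
    {d : ℕ} (hd : 0 < d) (hφ : φ ≫ φ = -(d • 𝟙 A)) (hE2 : Module.finrank ℚ A.endAlgebra = 2)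
    (h52 : eigenMultiplicity A φ (Complex.I * (Real.sqrt d : ℂ)) = 52)
    (h31 : eigenMultiplicity A φ (-(Complex.I * (Real.sqrt d : ℂ))) = 31) (N : ℕ) :
    IsDivisorGenerated (A.powSucc N) := by
  refine AbelianVariety.isDivisorGenerated_powSucc_of_ribetType_ofCoreSmul A φ hd hφ hE2 (by omega) (by omega) ?_ N
  intro W' _ _ _ 𝔊 ι P' Q' s hbr hirr hι hιι hP' hQ' hfinP' hfinQ' hadd hsmul hsymm hPQ hdefP hdefQ hadj
  exact UnitaryThirtyOneFiftyTwo.eq_top_of_smul' hbr hirr hι hιι hP' hQ' (by rw [hfinP', h52]) (by rw [hfinQ', h31])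
    hadd hsmul hsymm hPQ hdefP hdefQ hadj

/-- **The Hodge conjecture for all powers `A^{N+1}` of an abelian variety of Ribet type `(31, 52)` — UNCONDITIONAL.**
[cite: Ribet1983, Thm. 3] [cite: Deligne2000, §1] -/
theorem hodgeConjectureFor_powSucc_of_ribetTypeThirtyOneFiftyTwo (A : AbelianVariety ℂ) (φ : A ⟶ A)
    {d : ℕ} (hd : 0 < d) (hφ : φ ≫ φ = -(d • 𝟙 A)) (hE2 : Module.finrank ℚ A.endAlgebra = 2)
    (h31 : eigenMultiplicity A φ (Complex.I * (Real.sqrt d : ℂ)) = 31)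
    (h52 : eigenMultiplicity A φ (-(Complex.I * (Real.sqrt d : ℂ))) = 52) (N : ℕ) :
    HodgeConjectureFor (A.powSucc N).dim (A.powSucc N).X :=
  hodgeConjectureFor_of_isDivisorGenerated _
    (AbelianVariety.isDivisorGenerated_powSucc_of_ribetTypeThirtyOneFiftyTwo A φ hd hφ hE2 h31 h52 N)

/-- **83-FOLDS of signature `{31, 52}`: `B• = D•` on all powers — UNCONDITIONAL** (either eigenvalue may carry the `31`).
[cite: Ribet1983, Thm. 0 and Thm. 3] [cite: MoonenZarhin1999LowDim, §2 (2.4)] -/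
theorem AbelianVariety.isDivisorGenerated_powSucc_of_eightythreefold_thirtyOneFiftyTwo (A : AbelianVariety ℂ)
    (φ : A ⟶ A) {d : ℕ} (hd : 0 < d) (hφ : φ ≫ φ = -(d • 𝟙 A)) (hE2 : Module.finrank ℚ A.endAlgebra = 2)
    (hX : A.dim = 83)
    (h31 : eigenMultiplicity A φ (Complex.I * (Real.sqrt d : ℂ)) = 31 ∨
      eigenMultiplicity A φ (-(Complex.I * (Real.sqrt d : ℂ))) = 31)
    (N : ℕ) : IsDivisorGenerated (A.powSucc N) := by
  have hsum := eigenMultiplicity_add_eigenMultiplicity_neg_eq_dim A φ hd hφ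
  rw [hX] at hsum
  rcases h31 with h | h
  · exact AbelianVariety.isDivisorGenerated_powSucc_of_ribetTypeThirtyOneFiftyTwo A φ hd hφ hE2 h (by omega) N
  · exact AbelianVariety.isDivisorGenerated_powSucc_of_ribetTypeThirtyOneFiftyTwo' A φ hd hφ hE2 (by omega) h N

/-- **The Hodge conjecture for all powers of a 83-FOLD of signature `{31, 52}` — UNCONDITIONAL.**
[cite: Ribet1983, Thm. 3] [cite: Deligne2000, §1] -/
theorem hodgeConjectureFor_powSucc_of_eightythreefold_thirtyOneFiftyTwo (A : AbelianVariety ℂ)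
    (φ : A ⟶ A) {d : ℕ} (hd : 0 < d) (hφ : φ ≫ φ = -(d • 𝟙 A)) (hE2 : Module.finrank ℚ A.endAlgebra = 2)
    (hX : A.dim = 83)
    (h31 : eigenMultiplicity A φ (Complex.I * (Real.sqrt d : ℂ)) = 31 ∨
      eigenMultiplicity A φ (-(Complex.I * (Real.sqrt d : ℂ))) = 31)
    (N : ℕ) : HodgeConjectureFor (A.powSucc N).dim (A.powSucc N).X :=
  hodgeConjectureFor_of_isDivisorGenerated _
    (AbelianVariety.isDivisorGenerated_powSucc_of_eightythreefold_thirtyOneFiftyTwo A φ hd hφ hE2 hX h31 N)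

/-- **Ribet 1983 Thm. 3 at `(n′, n″) = (32, 51)` — UNCONDITIONAL** (core `UnitaryThirtyTwoFiftyOne.eq_top_of_smul`).
[cite: Ribet1983, Thm. 0 and Thm. 3] [cite: Gordon1997, Thm. 6.3 (3) and Corollary] -/
theorem AbelianVariety.isDivisorGenerated_powSucc_of_ribetTypeThirtyTwoFiftyOne (A : AbelianVariety ℂ) (φ : A ⟶ A)
    {d : ℕ} (hd : 0 < d) (hφ : φ ≫ φ = -(d • 𝟙 A)) (hE2 : Module.finrank ℚ A.endAlgebra = 2)
    (h32 : eigenMultiplicity A φ (Complex.I * (Real.sqrt d : ℂ)) = 32)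
    (h51 : eigenMultiplicity A φ (-(Complex.I * (Real.sqrt d : ℂ))) = 51) (N : ℕ) :
    IsDivisorGenerated (A.powSucc N) := by
  refine AbelianVariety.isDivisorGenerated_powSucc_of_ribetType_ofCoreSmul A φ hd hφ hE2 (by omega) (by omega) ?_ N
  intro W' _ _ _ 𝔊 ι P' Q' s hbr hirr hι hιι hP' hQ' hfinP' hfinQ' hadd hsmul hsymm hPQ hdefP hdefQ hadj
  exact UnitaryThirtyTwoFiftyOne.eq_top_of_smul hbr hirr hι hιι hP' hQ' (by rw [hfinP', h32]) (by rw [hfinQ', h51]) hadd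
    hsmul hsymm hPQ hdefP hdefQ hadj

/-- The mirror: `n_{i√d}(φ) = 51`, `n_{−i√d}(φ) = 32` (core `UnitaryThirtyTwoFiftyOne.eq_top_of_smul'`).
[cite: Ribet1983, Thm. 0 and Thm. 3] [cite: Gordon1997, Thm. 6.3 (3) and Corollary] -/
theorem AbelianVariety.isDivisorGenerated_powSucc_of_ribetTypeThirtyTwoFiftyOne' (A : AbelianVariety ℂ) (φ : A ⟶ A)
    {d : ℕ} (hd : 0 < d) (hφ : φ ≫ φ = -(d • 𝟙 A)) (hE2 : Module.finrank ℚ A.endAlgebra = 2)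
    (h51 : eigenMultiplicity A φ (Complex.I * (Real.sqrt d : ℂ)) = 51)
    (h32 : eigenMultiplicity A φ (-(Complex.I * (Real.sqrt d : ℂ))) = 32) (N : ℕ) :
    IsDivisorGenerated (A.powSucc N) := by
  refine AbelianVariety.isDivisorGenerated_powSucc_of_ribetType_ofCoreSmul A φ hd hφ hE2 (by omega) (by omega) ?_ N
  intro W' _ _ _ 𝔊 ι P' Q' s hbr hirr hι hιι hP' hQ' hfinP' hfinQ' hadd hsmul hsymm hPQ hdefP hdefQ hadj
  exact UnitaryThirtyTwoFiftyOne.eq_top_of_smul' hbr hirr hι hιι hP' hQ' (by rw [hfinP', h51]) (by rw [hfinQ', h32])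
    hadd hsmul hsymm hPQ hdefP hdefQ hadj

/-- **The Hodge conjecture for all powers `A^{N+1}` of an abelian variety of Ribet type `(32, 51)` — UNCONDITIONAL.**
[cite: Ribet1983, Thm. 3] [cite: Deligne2000, §1] -/
theorem hodgeConjectureFor_powSucc_of_ribetTypeThirtyTwoFiftyOne (A : AbelianVariety ℂ) (φ : A ⟶ A)
    {d : ℕ} (hd : 0 < d) (hφ : φ ≫ φ = -(d • 𝟙 A)) (hE2 : Module.finrank ℚ A.endAlgebra = 2)
    (h32 : eigenMultiplicity A φ (Complex.I * (Real.sqrt d : ℂ)) = 32)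
    (h51 : eigenMultiplicity A φ (-(Complex.I * (Real.sqrt d : ℂ))) = 51) (N : ℕ) :
    HodgeConjectureFor (A.powSucc N).dim (A.powSucc N).X :=
  hodgeConjectureFor_of_isDivisorGenerated _
    (AbelianVariety.isDivisorGenerated_powSucc_of_ribetTypeThirtyTwoFiftyOne A φ hd hφ hE2 h32 h51 N)

/-- **83-FOLDS of signature `{32, 51}`: `B• = D•` on all powers — UNCONDITIONAL** (either eigenvalue may carry the `32`).
[cite: Ribet1983, Thm. 0 and Thm. 3] [cite: MoonenZarhin1999LowDim, §2 (2.4)] -/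
theorem AbelianVariety.isDivisorGenerated_powSucc_of_eightythreefold_thirtyTwoFiftyOne (A : AbelianVariety ℂ)
    (φ : A ⟶ A) {d : ℕ} (hd : 0 < d) (hφ : φ ≫ φ = -(d • 𝟙 A)) (hE2 : Module.finrank ℚ A.endAlgebra = 2)
    (hX : A.dim = 83)
    (h32 : eigenMultiplicity A φ (Complex.I * (Real.sqrt d : ℂ)) = 32 ∨
      eigenMultiplicity A φ (-(Complex.I * (Real.sqrt d : ℂ))) = 32)
    (N : ℕ) : IsDivisorGenerated (A.powSucc N) := by
  have hsum := eigenMultiplicity_add_eigenMultiplicity_neg_eq_dim A φ hd hφ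
  rw [hX] at hsum
  rcases h32 with h | h
  · exact AbelianVariety.isDivisorGenerated_powSucc_of_ribetTypeThirtyTwoFiftyOne A φ hd hφ hE2 h (by omega) N
  · exact AbelianVariety.isDivisorGenerated_powSucc_of_ribetTypeThirtyTwoFiftyOne' A φ hd hφ hE2 (by omega) h N

/-- **The Hodge conjecture for all powers of a 83-FOLD of signature `{32, 51}` — UNCONDITIONAL.**
[cite: Ribet1983, Thm. 3] [cite: Deligne2000, §1] -/
theorem hodgeConjectureFor_powSucc_of_eightythreefold_thirtyTwoFiftyOne (A : AbelianVariety ℂ)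
    (φ : A ⟶ A) {d : ℕ} (hd : 0 < d) (hφ : φ ≫ φ = -(d • 𝟙 A)) (hE2 : Module.finrank ℚ A.endAlgebra = 2)
    (hX : A.dim = 83)
    (h32 : eigenMultiplicity A φ (Complex.I * (Real.sqrt d : ℂ)) = 32 ∨
      eigenMultiplicity A φ (-(Complex.I * (Real.sqrt d : ℂ))) = 32)
    (N : ℕ) : HodgeConjectureFor (A.powSucc N).dim (A.powSucc N).X :=
  hodgeConjectureFor_of_isDivisorGenerated _
    (AbelianVariety.isDivisorGenerated_powSucc_of_eightythreefold_thirtyTwoFiftyOne A φ hd hφ hE2 hX h32 N)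

/-- **Ribet 1983 Thm. 3 at `(n′, n″) = (33, 50)` — UNCONDITIONAL** (core `UnitaryThirtyThreeFifty.eq_top_of_smul`).
[cite: Ribet1983, Thm. 0 and Thm. 3] [cite: Gordon1997, Thm. 6.3 (3) and Corollary] -/
theorem AbelianVariety.isDivisorGenerated_powSucc_of_ribetTypeThirtyThreeFifty (A : AbelianVariety ℂ) (φ : A ⟶ A)
    {d : ℕ} (hd : 0 < d) (hφ : φ ≫ φ = -(d • 𝟙 A)) (hE2 : Module.finrank ℚ A.endAlgebra = 2)
    (h33 : eigenMultiplicity A φ (Complex.I * (Real.sqrt d : ℂ)) = 33)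
    (h50 : eigenMultiplicity A φ (-(Complex.I * (Real.sqrt d : ℂ))) = 50) (N : ℕ) :
    IsDivisorGenerated (A.powSucc N) := by
  refine AbelianVariety.isDivisorGenerated_powSucc_of_ribetType_ofCoreSmul A φ hd hφ hE2 (by omega) (by omega) ?_ N
  intro W' _ _ _ 𝔊 ι P' Q' s hbr hirr hι hιι hP' hQ' hfinP' hfinQ' hadd hsmul hsymm hPQ hdefP hdefQ hadj
  exact UnitaryThirtyThreeFifty.eq_top_of_smul hbr hirr hι hιι hP' hQ' (by rw [hfinP', h33]) (by rw [hfinQ', h50]) hadd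
    hsmul hsymm hPQ hdefP hdefQ hadj

/-- The mirror: `n_{i√d}(φ) = 50`, `n_{−i√d}(φ) = 33` (core `UnitaryThirtyThreeFifty.eq_top_of_smul'`).
[cite: Ribet1983, Thm. 0 and Thm. 3] [cite: Gordon1997, Thm. 6.3 (3) and Corollary] -/
theorem AbelianVariety.isDivisorGenerated_powSucc_of_ribetTypeThirtyThreeFifty' (A : AbelianVariety ℂ) (φ : A ⟶ A)
    {d : ℕ} (hd : 0 < d) (hφ : φ ≫ φ = -(d • 𝟙 A)) (hE2 : Module.finrank ℚ A.endAlgebra = 2)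
    (h50 : eigenMultiplicity A φ (Complex.I * (Real.sqrt d : ℂ)) = 50)
    (h33 : eigenMultiplicity A φ (-(Complex.I * (Real.sqrt d : ℂ))) = 33) (N : ℕ) :
    IsDivisorGenerated (A.powSucc N) := by
  refine AbelianVariety.isDivisorGenerated_powSucc_of_ribetType_ofCoreSmul A φ hd hφ hE2 (by omega) (by omega) ?_ N
  intro W' _ _ _ 𝔊 ι P' Q' s hbr hirr hι hιι hP' hQ' hfinP' hfinQ' hadd hsmul hsymm hPQ hdefP hdefQ hadj
  exact UnitaryThirtyThreeFifty.eq_top_of_smul' hbr hirr hι hιι hP' hQ' (by rw [hfinP', h50]) (by rw [hfinQ', h33])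
    hadd hsmul hsymm hPQ hdefP hdefQ hadj

/-- **The Hodge conjecture for all powers `A^{N+1}` of an abelian variety of Ribet type `(33, 50)` — UNCONDITIONAL.**
[cite: Ribet1983, Thm. 3] [cite: Deligne2000, §1] -/
theorem hodgeConjectureFor_powSucc_of_ribetTypeThirtyThreeFifty (A : AbelianVariety ℂ) (φ : A ⟶ A)
    {d : ℕ} (hd : 0 < d) (hφ : φ ≫ φ = -(d • 𝟙 A)) (hE2 : Module.finrank ℚ A.endAlgebra = 2)
    (h33 : eigenMultiplicity A φ (Complex.I * (Real.sqrt d : ℂ)) = 33)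
    (h50 : eigenMultiplicity A φ (-(Complex.I * (Real.sqrt d : ℂ))) = 50) (N : ℕ) :
    HodgeConjectureFor (A.powSucc N).dim (A.powSucc N).X :=
  hodgeConjectureFor_of_isDivisorGenerated _
    (AbelianVariety.isDivisorGenerated_powSucc_of_ribetTypeThirtyThreeFifty A φ hd hφ hE2 h33 h50 N)

/-- **83-FOLDS of signature `{33, 50}`: `B• = D•` on all powers — UNCONDITIONAL** (either eigenvalue may carry the `33`).
[cite: Ribet1983, Thm. 0 and Thm. 3] [cite: MoonenZarhin1999LowDim, §2 (2.4)] -/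
theorem AbelianVariety.isDivisorGenerated_powSucc_of_eightythreefold_thirtyThreeFifty (A : AbelianVariety ℂ)
    (φ : A ⟶ A) {d : ℕ} (hd : 0 < d) (hφ : φ ≫ φ = -(d • 𝟙 A)) (hE2 : Module.finrank ℚ A.endAlgebra = 2)
    (hX : A.dim = 83)
    (h33 : eigenMultiplicity A φ (Complex.I * (Real.sqrt d : ℂ)) = 33 ∨
      eigenMultiplicity A φ (-(Complex.I * (Real.sqrt d : ℂ))) = 33)
    (N : ℕ) : IsDivisorGenerated (A.powSucc N) := by
  have hsum := eigenMultiplicity_add_eigenMultiplicity_neg_eq_dim A φ hd hφ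
  rw [hX] at hsum
  rcases h33 with h | h
  · exact AbelianVariety.isDivisorGenerated_powSucc_of_ribetTypeThirtyThreeFifty A φ hd hφ hE2 h (by omega) N
  · exact AbelianVariety.isDivisorGenerated_powSucc_of_ribetTypeThirtyThreeFifty' A φ hd hφ hE2 (by omega) h N

/-- **The Hodge conjecture for all powers of a 83-FOLD of signature `{33, 50}` — UNCONDITIONAL.**
[cite: Ribet1983, Thm. 3] [cite: Deligne2000, §1] -/
theorem hodgeConjectureFor_powSucc_of_eightythreefold_thirtyThreeFifty (A : AbelianVariety ℂ)
    (φ : A ⟶ A) {d : ℕ} (hd : 0 < d) (hφ : φ ≫ φ = -(d • 𝟙 A)) (hE2 : Module.finrank ℚ A.endAlgebra = 2)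
    (hX : A.dim = 83)
    (h33 : eigenMultiplicity A φ (Complex.I * (Real.sqrt d : ℂ)) = 33 ∨
      eigenMultiplicity A φ (-(Complex.I * (Real.sqrt d : ℂ))) = 33)
    (N : ℕ) : HodgeConjectureFor (A.powSucc N).dim (A.powSucc N).X :=
  hodgeConjectureFor_of_isDivisorGenerated _
    (AbelianVariety.isDivisorGenerated_powSucc_of_eightythreefold_thirtyThreeFifty A φ hd hφ hE2 hX h33 N)

/-- **Ribet 1983 Thm. 3 at `(n′, n″) = (34, 49)` — UNCONDITIONAL** (core `UnitaryThirtyFourFortyNine.eq_top_of_smul`).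
[cite: Ribet1983, Thm. 0 and Thm. 3] [cite: Gordon1997, Thm. 6.3 (3) and Corollary] -/
theorem AbelianVariety.isDivisorGenerated_powSucc_of_ribetTypeThirtyFourFortyNine (A : AbelianVariety ℂ) (φ : A ⟶ A)
    {d : ℕ} (hd : 0 < d) (hφ : φ ≫ φ = -(d • 𝟙 A)) (hE2 : Module.finrank ℚ A.endAlgebra = 2)
    (h34 : eigenMultiplicity A φ (Complex.I * (Real.sqrt d : ℂ)) = 34)
    (h49 : eigenMultiplicity A φ (-(Complex.I * (Real.sqrt d : ℂ))) = 49) (N : ℕ) :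
    IsDivisorGenerated (A.powSucc N) := by
  refine AbelianVariety.isDivisorGenerated_powSucc_of_ribetType_ofCoreSmul A φ hd hφ hE2 (by omega) (by omega) ?_ N
  intro W' _ _ _ 𝔊 ι P' Q' s hbr hirr hι hιι hP' hQ' hfinP' hfinQ' hadd hsmul hsymm hPQ hdefP hdefQ hadj
  exact UnitaryThirtyFourFortyNine.eq_top_of_smul hbr hirr hι hιι hP' hQ' (by rw [hfinP', h34]) (by rw [hfinQ', h49]) hadd
    hsmul hsymm hPQ hdefP hdefQ hadj

/-- The mirror: `n_{i√d}(φ) = 49`, `n_{−i√d}(φ) = 34` (core `UnitaryThirtyFourFortyNine.eq_top_of_smul'`).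
[cite: Ribet1983, Thm. 0 and Thm. 3] [cite: Gordon1997, Thm. 6.3 (3) and Corollary] -/
theorem AbelianVariety.isDivisorGenerated_powSucc_of_ribetTypeThirtyFourFortyNine' (A : AbelianVariety ℂ) (φ : A ⟶ A)
    {d : ℕ} (hd : 0 < d) (hφ : φ ≫ φ = -(d • 𝟙 A)) (hE2 : Module.finrank ℚ A.endAlgebra = 2)
    (h49 : eigenMultiplicity A φ (Complex.I * (Real.sqrt d : ℂ)) = 49)
    (h34 : eigenMultiplicity A φ (-(Complex.I * (Real.sqrt d : ℂ))) = 34) (N : ℕ) :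
    IsDivisorGenerated (A.powSucc N) := by
  refine AbelianVariety.isDivisorGenerated_powSucc_of_ribetType_ofCoreSmul A φ hd hφ hE2 (by omega) (by omega) ?_ N
  intro W' _ _ _ 𝔊 ι P' Q' s hbr hirr hι hιι hP' hQ' hfinP' hfinQ' hadd hsmul hsymm hPQ hdefP hdefQ hadj
  exact UnitaryThirtyFourFortyNine.eq_top_of_smul' hbr hirr hι hιι hP' hQ' (by rw [hfinP', h49]) (by rw [hfinQ', h34])
    hadd hsmul hsymm hPQ hdefP hdefQ hadj

/-- **The Hodge conjecture for all powers `A^{N+1}` of an abelian variety of Ribet type `(34, 49)` — UNCONDITIONAL.**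
[cite: Ribet1983, Thm. 3] [cite: Deligne2000, §1] -/
theorem hodgeConjectureFor_powSucc_of_ribetTypeThirtyFourFortyNine (A : AbelianVariety ℂ) (φ : A ⟶ A)
    {d : ℕ} (hd : 0 < d) (hφ : φ ≫ φ = -(d • 𝟙 A)) (hE2 : Module.finrank ℚ A.endAlgebra = 2)
    (h34 : eigenMultiplicity A φ (Complex.I * (Real.sqrt d : ℂ)) = 34)
    (h49 : eigenMultiplicity A φ (-(Complex.I * (Real.sqrt d : ℂ))) = 49) (N : ℕ) :
    HodgeConjectureFor (A.powSucc N).dim (A.powSucc N).X :=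
  hodgeConjectureFor_of_isDivisorGenerated _
    (AbelianVariety.isDivisorGenerated_powSucc_of_ribetTypeThirtyFourFortyNine A φ hd hφ hE2 h34 h49 N)

/-- **83-FOLDS of signature `{34, 49}`: `B• = D•` on all powers — UNCONDITIONAL** (either eigenvalue may carry the `34`).
[cite: Ribet1983, Thm. 0 and Thm. 3] [cite: MoonenZarhin1999LowDim, §2 (2.4)] -/
theorem AbelianVariety.isDivisorGenerated_powSucc_of_eightythreefold_thirtyFourFortyNine (A : AbelianVariety ℂ)
    (φ : A ⟶ A) {d : ℕ} (hd : 0 < d) (hφ : φ ≫ φ = -(d • 𝟙 A)) (hE2 : Module.finrank ℚ A.endAlgebra = 2)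
    (hX : A.dim = 83)
    (h34 : eigenMultiplicity A φ (Complex.I * (Real.sqrt d : ℂ)) = 34 ∨
      eigenMultiplicity A φ (-(Complex.I * (Real.sqrt d : ℂ))) = 34)
    (N : ℕ) : IsDivisorGenerated (A.powSucc N) := by
  have hsum := eigenMultiplicity_add_eigenMultiplicity_neg_eq_dim A φ hd hφ
  rw [hX] at hsum
  rcases h34 with h | h
  · exact AbelianVariety.isDivisorGenerated_powSucc_of_ribetTypeThirtyFourFortyNine A φ hd hφ hE2 h (by omega) N
  · exact AbelianVariety.isDivisorGenerated_powSucc_of_ribetTypeThirtyFourFortyNine' A φ hd hφ hE2 (by omega) h N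

/-- **The Hodge conjecture for all powers of a 83-FOLD of signature `{34, 49}` — UNCONDITIONAL.**
[cite: Ribet1983, Thm. 3] [cite: Deligne2000, §1] -/
theorem hodgeConjectureFor_powSucc_of_eightythreefold_thirtyFourFortyNine (A : AbelianVariety ℂ)
    (φ : A ⟶ A) {d : ℕ} (hd : 0 < d) (hφ : φ ≫ φ = -(d • 𝟙 A)) (hE2 : Module.finrank ℚ A.endAlgebra = 2)
    (hX : A.dim = 83)
    (h34 : eigenMultiplicity A φ (Complex.I * (Real.sqrt d : ℂ)) = 34 ∨
      eigenMultiplicity A φ (-(Complex.I * (Real.sqrt d : ℂ))) = 34)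
    (N : ℕ) : HodgeConjectureFor (A.powSucc N).dim (A.powSucc N).X :=
  hodgeConjectureFor_of_isDivisorGenerated _
    (AbelianVariety.isDivisorGenerated_powSucc_of_eightythreefold_thirtyFourFortyNine A φ hd hφ hE2 hX h34 N)

/-- **Ribet 1983 Thm. 3 at `(n′, n″) = (35, 48)` — UNCONDITIONAL** (core `UnitaryThirtyFiveFortyEight.eq_top_of_smul`).
[cite: Ribet1983, Thm. 0 and Thm. 3] [cite: Gordon1997, Thm. 6.3 (3) and Corollary] -/
theorem AbelianVariety.isDivisorGenerated_powSucc_of_ribetTypeThirtyFiveFortyEight (A : AbelianVariety ℂ) (φ : A ⟶ A)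
    {d : ℕ} (hd : 0 < d) (hφ : φ ≫ φ = -(d • 𝟙 A)) (hE2 : Module.finrank ℚ A.endAlgebra = 2)
    (h35 : eigenMultiplicity A φ (Complex.I * (Real.sqrt d : ℂ)) = 35)
    (h48 : eigenMultiplicity A φ (-(Complex.I * (Real.sqrt d : ℂ))) = 48) (N : ℕ) :
    IsDivisorGenerated (A.powSucc N) := by
  refine AbelianVariety.isDivisorGenerated_powSucc_of_ribetType_ofCoreSmul A φ hd hφ hE2 (by omega) (by omega) ?_ N
  intro W' _ _ _ 𝔊 ι P' Q' s hbr hirr hι hιι hP' hQ' hfinP' hfinQ' hadd hsmul hsymm hPQ hdefP hdefQ hadj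
  exact UnitaryThirtyFiveFortyEight.eq_top_of_smul hbr hirr hι hιι hP' hQ' (by rw [hfinP', h35]) (by rw [hfinQ', h48]) hadd
    hsmul hsymm hPQ hdefP hdefQ hadj

/-- The mirror: `n_{i√d}(φ) = 48`, `n_{−i√d}(φ) = 35` (core `UnitaryThirtyFiveFortyEight.eq_top_of_smul'`).
[cite: Ribet1983, Thm. 0 and Thm. 3] [cite: Gordon1997, Thm. 6.3 (3) and Corollary] -/
theorem AbelianVariety.isDivisorGenerated_powSucc_of_ribetTypeThirtyFiveFortyEight' (A : AbelianVariety ℂ) (φ : A ⟶ A)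
    {d : ℕ} (hd : 0 < d) (hφ : φ ≫ φ = -(d • 𝟙 A)) (hE2 : Module.finrank ℚ A.endAlgebra = 2)
    (h48 : eigenMultiplicity A φ (Complex.I * (Real.sqrt d : ℂ)) = 48)
    (h35 : eigenMultiplicity A φ (-(Complex.I * (Real.sqrt d : ℂ))) = 35) (N : ℕ) :
    IsDivisorGenerated (A.powSucc N) := by
  refine AbelianVariety.isDivisorGenerated_powSucc_of_ribetType_ofCoreSmul A φ hd hφ hE2 (by omega) (by omega) ?_ N
  intro W' _ _ _ 𝔊 ι P' Q' s hbr hirr hι hιι hP' hQ' hfinP' hfinQ' hadd hsmul hsymm hPQ hdefP hdefQ hadj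
  exact UnitaryThirtyFiveFortyEight.eq_top_of_smul' hbr hirr hι hιι hP' hQ' (by rw [hfinP', h48]) (by rw [hfinQ', h35])
    hadd hsmul hsymm hPQ hdefP hdefQ hadj

/-- **The Hodge conjecture for all powers `A^{N+1}` of an abelian variety of Ribet type `(35, 48)` — UNCONDITIONAL.**
[cite: Ribet1983, Thm. 3] [cite: Deligne2000, §1] -/
theorem hodgeConjectureFor_powSucc_of_ribetTypeThirtyFiveFortyEight (A : AbelianVariety ℂ) (φ : A ⟶ A)
    {d : ℕ} (hd : 0 < d) (hφ : φ ≫ φ = -(d • 𝟙 A)) (hE2 : Module.finrank ℚ A.endAlgebra = 2)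
    (h35 : eigenMultiplicity A φ (Complex.I * (Real.sqrt d : ℂ)) = 35)
    (h48 : eigenMultiplicity A φ (-(Complex.I * (Real.sqrt d : ℂ))) = 48) (N : ℕ) :
    HodgeConjectureFor (A.powSucc N).dim (A.powSucc N).X :=
  hodgeConjectureFor_of_isDivisorGenerated _
    (AbelianVariety.isDivisorGenerated_powSucc_of_ribetTypeThirtyFiveFortyEight A φ hd hφ hE2 h35 h48 N)

/-- **83-FOLDS of signature `{35, 48}`: `B• = D•` on all powers — UNCONDITIONAL** (either eigenvalue may carry the `35`).
[cite: Ribet1983, Thm. 0 and Thm. 3] [cite: MoonenZarhin1999LowDim, §2 (2.4)] -/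
theorem AbelianVariety.isDivisorGenerated_powSucc_of_eightythreefold_thirtyFiveFortyEight (A : AbelianVariety ℂ)
    (φ : A ⟶ A) {d : ℕ} (hd : 0 < d) (hφ : φ ≫ φ = -(d • 𝟙 A)) (hE2 : Module.finrank ℚ A.endAlgebra = 2)
    (hX : A.dim = 83)
    (h35 : eigenMultiplicity A φ (Complex.I * (Real.sqrt d : ℂ)) = 35 ∨
      eigenMultiplicity A φ (-(Complex.I * (Real.sqrt d : ℂ))) = 35)
    (N : ℕ) : IsDivisorGenerated (A.powSucc N) := by
  have hsum := eigenMultiplicity_add_eigenMultiplicity_neg_eq_dim A φ hd hφ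
  rw [hX] at hsum
  rcases h35 with h | h
  · exact AbelianVariety.isDivisorGenerated_powSucc_of_ribetTypeThirtyFiveFortyEight A φ hd hφ hE2 h (by omega) N
  · exact AbelianVariety.isDivisorGenerated_powSucc_of_ribetTypeThirtyFiveFortyEight' A φ hd hφ hE2 (by omega) h N

/-- **The Hodge conjecture for all powers of a 83-FOLD of signature `{35, 48}` — UNCONDITIONAL.**
[cite: Ribet1983, Thm. 3] [cite: Deligne2000, §1] -/
theorem hodgeConjectureFor_powSucc_of_eightythreefold_thirtyFiveFortyEight (A : AbelianVariety ℂ)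
    (φ : A ⟶ A) {d : ℕ} (hd : 0 < d) (hφ : φ ≫ φ = -(d • 𝟙 A)) (hE2 : Module.finrank ℚ A.endAlgebra = 2)
    (hX : A.dim = 83)
    (h35 : eigenMultiplicity A φ (Complex.I * (Real.sqrt d : ℂ)) = 35 ∨
      eigenMultiplicity A φ (-(Complex.I * (Real.sqrt d : ℂ))) = 35)
    (N : ℕ) : HodgeConjectureFor (A.powSucc N).dim (A.powSucc N).X :=
  hodgeConjectureFor_of_isDivisorGenerated _
    (AbelianVariety.isDivisorGenerated_powSucc_of_eightythreefold_thirtyFiveFortyEight A φ hd hφ hE2 hX h35 N)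

/-- **Ribet 1983 Thm. 3 at `(n′, n″) = (37, 46)` — UNCONDITIONAL** (core `UnitaryThirtySevenFortySix.eq_top_of_smul`).
[cite: Ribet1983, Thm. 0 and Thm. 3] [cite: Gordon1997, Thm. 6.3 (3) and Corollary] -/
theorem AbelianVariety.isDivisorGenerated_powSucc_of_ribetTypeThirtySevenFortySix (A : AbelianVariety ℂ) (φ : A ⟶ A)
    {d : ℕ} (hd : 0 < d) (hφ : φ ≫ φ = -(d • 𝟙 A)) (hE2 : Module.finrank ℚ A.endAlgebra = 2)
    (h37 : eigenMultiplicity A φ (Complex.I * (Real.sqrt d : ℂ)) = 37)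
    (h46 : eigenMultiplicity A φ (-(Complex.I * (Real.sqrt d : ℂ))) = 46) (N : ℕ) :
    IsDivisorGenerated (A.powSucc N) := by
  refine AbelianVariety.isDivisorGenerated_powSucc_of_ribetType_ofCoreSmul A φ hd hφ hE2 (by omega) (by omega) ?_ N
  intro W' _ _ _ 𝔊 ι P' Q' s hbr hirr hι hιι hP' hQ' hfinP' hfinQ' hadd hsmul hsymm hPQ hdefP hdefQ hadj
  exact UnitaryThirtySevenFortySix.eq_top_of_smul hbr hirr hι hιι hP' hQ' (by rw [hfinP', h37]) (by rw [hfinQ', h46]) hadd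
    hsmul hsymm hPQ hdefP hdefQ hadj

/-- The mirror: `n_{i√d}(φ) = 46`, `n_{−i√d}(φ) = 37` (core `UnitaryThirtySevenFortySix.eq_top_of_smul'`).
[cite: Ribet1983, Thm. 0 and Thm. 3] [cite: Gordon1997, Thm. 6.3 (3) and Corollary] -/
theorem AbelianVariety.isDivisorGenerated_powSucc_of_ribetTypeThirtySevenFortySix' (A : AbelianVariety ℂ) (φ : A ⟶ A)
    {d : ℕ} (hd : 0 < d) (hφ : φ ≫ φ = -(d • 𝟙 A)) (hE2 : Module.finrank ℚ A.endAlgebra = 2)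
    (h46 : eigenMultiplicity A φ (Complex.I * (Real.sqrt d : ℂ)) = 46)
    (h37 : eigenMultiplicity A φ (-(Complex.I * (Real.sqrt d : ℂ))) = 37) (N : ℕ) :
    IsDivisorGenerated (A.powSucc N) := by
  refine AbelianVariety.isDivisorGenerated_powSucc_of_ribetType_ofCoreSmul A φ hd hφ hE2 (by omega) (by omega) ?_ N
  intro W' _ _ _ 𝔊 ι P' Q' s hbr hirr hι hιι hP' hQ' hfinP' hfinQ' hadd hsmul hsymm hPQ hdefP hdefQ hadj
  exact UnitaryThirtySevenFortySix.eq_top_of_smul' hbr hirr hι hιι hP' hQ' (by rw [hfinP', h46]) (by rw [hfinQ', h37])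
    hadd hsmul hsymm hPQ hdefP hdefQ hadj

/-- **The Hodge conjecture for all powers `A^{N+1}` of an abelian variety of Ribet type `(37, 46)` — UNCONDITIONAL.**
[cite: Ribet1983, Thm. 3] [cite: Deligne2000, §1] -/
theorem hodgeConjectureFor_powSucc_of_ribetTypeThirtySevenFortySix (A : AbelianVariety ℂ) (φ : A ⟶ A)
    {d : ℕ} (hd : 0 < d) (hφ : φ ≫ φ = -(d • 𝟙 A)) (hE2 : Module.finrank ℚ A.endAlgebra = 2)
    (h37 : eigenMultiplicity A φ (Complex.I * (Real.sqrt d : ℂ)) = 37)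
    (h46 : eigenMultiplicity A φ (-(Complex.I * (Real.sqrt d : ℂ))) = 46) (N : ℕ) :
    HodgeConjectureFor (A.powSucc N).dim (A.powSucc N).X :=
  hodgeConjectureFor_of_isDivisorGenerated _
    (AbelianVariety.isDivisorGenerated_powSucc_of_ribetTypeThirtySevenFortySix A φ hd hφ hE2 h37 h46 N)

/-- **83-FOLDS of signature `{37, 46}`: `B• = D•` on all powers — UNCONDITIONAL** (either eigenvalue may carry the `37`).
[cite: Ribet1983, Thm. 0 and Thm. 3] [cite: MoonenZarhin1999LowDim, §2 (2.4)] -/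
theorem AbelianVariety.isDivisorGenerated_powSucc_of_eightythreefold_thirtySevenFortySix (A : AbelianVariety ℂ)
    (φ : A ⟶ A) {d : ℕ} (hd : 0 < d) (hφ : φ ≫ φ = -(d • 𝟙 A)) (hE2 : Module.finrank ℚ A.endAlgebra = 2)
    (hX : A.dim = 83)
    (h37 : eigenMultiplicity A φ (Complex.I * (Real.sqrt d : ℂ)) = 37 ∨
      eigenMultiplicity A φ (-(Complex.I * (Real.sqrt d : ℂ))) = 37)
    (N : ℕ) : IsDivisorGenerated (A.powSucc N) := by
  have hsum := eigenMultiplicity_add_eigenMultiplicity_neg_eq_dim A φ hd hφ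
  rw [hX] at hsum
  rcases h37 with h | h
  · exact AbelianVariety.isDivisorGenerated_powSucc_of_ribetTypeThirtySevenFortySix A φ hd hφ hE2 h (by omega) N
  · exact AbelianVariety.isDivisorGenerated_powSucc_of_ribetTypeThirtySevenFortySix' A φ hd hφ hE2 (by omega) h N

/-- **The Hodge conjecture for all powers of a 83-FOLD of signature `{37, 46}` — UNCONDITIONAL.**
[cite: Ribet1983, Thm. 3] [cite: Deligne2000, §1] -/
theorem hodgeConjectureFor_powSucc_of_eightythreefold_thirtySevenFortySix (A : AbelianVariety ℂ)
    (φ : A ⟶ A) {d : ℕ} (hd : 0 < d) (hφ : φ ≫ φ = -(d • 𝟙 A)) (hE2 : Module.finrank ℚ A.endAlgebra = 2)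
    (hX : A.dim = 83)
    (h37 : eigenMultiplicity A φ (Complex.I * (Real.sqrt d : ℂ)) = 37 ∨
      eigenMultiplicity A φ (-(Complex.I * (Real.sqrt d : ℂ))) = 37)
    (N : ℕ) : HodgeConjectureFor (A.powSucc N).dim (A.powSucc N).X :=
  hodgeConjectureFor_of_isDivisorGenerated _
    (AbelianVariety.isDivisorGenerated_powSucc_of_eightythreefold_thirtySevenFortySix A φ hd hφ hE2 hX h37 N)

/-- **Ribet 1983 Thm. 3 at `(n′, n″) = (38, 45)` — UNCONDITIONAL** (core `UnitaryThirtyEightFortyFive.eq_top_of_smul`).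
[cite: Ribet1983, Thm. 0 and Thm. 3] [cite: Gordon1997, Thm. 6.3 (3) and Corollary] -/
theorem AbelianVariety.isDivisorGenerated_powSucc_of_ribetTypeThirtyEightFortyFive (A : AbelianVariety ℂ) (φ : A ⟶ A)
    {d : ℕ} (hd : 0 < d) (hφ : φ ≫ φ = -(d • 𝟙 A)) (hE2 : Module.finrank ℚ A.endAlgebra = 2)
    (h38 : eigenMultiplicity A φ (Complex.I * (Real.sqrt d : ℂ)) = 38)
    (h45 : eigenMultiplicity A φ (-(Complex.I * (Real.sqrt d : ℂ))) = 45) (N : ℕ) :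
    IsDivisorGenerated (A.powSucc N) := by
  refine AbelianVariety.isDivisorGenerated_powSucc_of_ribetType_ofCoreSmul A φ hd hφ hE2 (by omega) (by omega) ?_ N
  intro W' _ _ _ 𝔊 ι P' Q' s hbr hirr hι hιι hP' hQ' hfinP' hfinQ' hadd hsmul hsymm hPQ hdefP hdefQ hadj
  exact UnitaryThirtyEightFortyFive.eq_top_of_smul hbr hirr hι hιι hP' hQ' (by rw [hfinP', h38]) (by rw [hfinQ', h45]) hadd
    hsmul hsymm hPQ hdefP hdefQ hadj

/-- The mirror: `n_{i√d}(φ) = 45`, `n_{−i√d}(φ) = 38` (core `UnitaryThirtyEightFortyFive.eq_top_of_smul'`).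
[cite: Ribet1983, Thm. 0 and Thm. 3] [cite: Gordon1997, Thm. 6.3 (3) and Corollary] -/
theorem AbelianVariety.isDivisorGenerated_powSucc_of_ribetTypeThirtyEightFortyFive' (A : AbelianVariety ℂ) (φ : A ⟶ A)
    {d : ℕ} (hd : 0 < d) (hφ : φ ≫ φ = -(d • 𝟙 A)) (hE2 : Module.finrank ℚ A.endAlgebra = 2)
    (h45 : eigenMultiplicity A φ (Complex.I * (Real.sqrt d : ℂ)) = 45)
    (h38 : eigenMultiplicity A φ (-(Complex.I * (Real.sqrt d : ℂ))) = 38) (N : ℕ) :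
    IsDivisorGenerated (A.powSucc N) := by
  refine AbelianVariety.isDivisorGenerated_powSucc_of_ribetType_ofCoreSmul A φ hd hφ hE2 (by omega) (by omega) ?_ N
  intro W' _ _ _ 𝔊 ι P' Q' s hbr hirr hι hιι hP' hQ' hfinP' hfinQ' hadd hsmul hsymm hPQ hdefP hdefQ hadj
  exact UnitaryThirtyEightFortyFive.eq_top_of_smul' hbr hirr hι hιι hP' hQ' (by rw [hfinP', h45]) (by rw [hfinQ', h38])
    hadd hsmul hsymm hPQ hdefP hdefQ hadj

/-- **The Hodge conjecture for all powers `A^{N+1}` of an abelian variety of Ribet type `(38, 45)` — UNCONDITIONAL.**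
[cite: Ribet1983, Thm. 3] [cite: Deligne2000, §1] -/
theorem hodgeConjectureFor_powSucc_of_ribetTypeThirtyEightFortyFive (A : AbelianVariety ℂ) (φ : A ⟶ A)
    {d : ℕ} (hd : 0 < d) (hφ : φ ≫ φ = -(d • 𝟙 A)) (hE2 : Module.finrank ℚ A.endAlgebra = 2)
    (h38 : eigenMultiplicity A φ (Complex.I * (Real.sqrt d : ℂ)) = 38)
    (h45 : eigenMultiplicity A φ (-(Complex.I * (Real.sqrt d : ℂ))) = 45) (N : ℕ) :
    HodgeConjectureFor (A.powSucc N).dim (A.powSucc N).X :=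
  hodgeConjectureFor_of_isDivisorGenerated _
    (AbelianVariety.isDivisorGenerated_powSucc_of_ribetTypeThirtyEightFortyFive A φ hd hφ hE2 h38 h45 N)

/-- **83-FOLDS of signature `{38, 45}`: `B• = D•` on all powers — UNCONDITIONAL** (either eigenvalue may carry the `38`).
[cite: Ribet1983, Thm. 0 and Thm. 3] [cite: MoonenZarhin1999LowDim, §2 (2.4)] -/
theorem AbelianVariety.isDivisorGenerated_powSucc_of_eightythreefold_thirtyEightFortyFive (A : AbelianVariety ℂ)
    (φ : A ⟶ A) {d : ℕ} (hd : 0 < d) (hφ : φ ≫ φ = -(d • 𝟙 A)) (hE2 : Module.finrank ℚ A.endAlgebra = 2)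
    (hX : A.dim = 83)
    (h38 : eigenMultiplicity A φ (Complex.I * (Real.sqrt d : ℂ)) = 38 ∨
      eigenMultiplicity A φ (-(Complex.I * (Real.sqrt d : ℂ))) = 38)
    (N : ℕ) : IsDivisorGenerated (A.powSucc N) := by
  have hsum := eigenMultiplicity_add_eigenMultiplicity_neg_eq_dim A φ hd hφ
  rw [hX] at hsum
  rcases h38 with h | h
  · exact AbelianVariety.isDivisorGenerated_powSucc_of_ribetTypeThirtyEightFortyFive A φ hd hφ hE2 h (by omega) N
  · exact AbelianVariety.isDivisorGenerated_powSucc_of_ribetTypeThirtyEightFortyFive' A φ hd hφ hE2 (by omega) h N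

/-- **The Hodge conjecture for all powers of a 83-FOLD of signature `{38, 45}` — UNCONDITIONAL.**
[cite: Ribet1983, Thm. 3] [cite: Deligne2000, §1] -/
theorem hodgeConjectureFor_powSucc_of_eightythreefold_thirtyEightFortyFive (A : AbelianVariety ℂ)
    (φ : A ⟶ A) {d : ℕ} (hd : 0 < d) (hφ : φ ≫ φ = -(d • 𝟙 A)) (hE2 : Module.finrank ℚ A.endAlgebra = 2)
    (hX : A.dim = 83)
    (h38 : eigenMultiplicity A φ (Complex.I * (Real.sqrt d : ℂ)) = 38 ∨
      eigenMultiplicity A φ (-(Complex.I * (Real.sqrt d : ℂ))) = 38)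
    (N : ℕ) : HodgeConjectureFor (A.powSucc N).dim (A.powSucc N).X :=
  hodgeConjectureFor_of_isDivisorGenerated _
    (AbelianVariety.isDivisorGenerated_powSucc_of_eightythreefold_thirtyEightFortyFive A φ hd hφ hE2 hX h38 N)

/-- **Ribet 1983 Thm. 3 at `(n′, n″) = (39, 44)` — UNCONDITIONAL** (core `UnitaryThirtyNineFortyFour.eq_top_of_smul`).
[cite: Ribet1983, Thm. 0 and Thm. 3] [cite: Gordon1997, Thm. 6.3 (3) and Corollary] -/
theorem AbelianVariety.isDivisorGenerated_powSucc_of_ribetTypeThirtyNineFortyFour (A : AbelianVariety ℂ) (φ : A ⟶ A)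
    {d : ℕ} (hd : 0 < d) (hφ : φ ≫ φ = -(d • 𝟙 A)) (hE2 : Module.finrank ℚ A.endAlgebra = 2)
    (h39 : eigenMultiplicity A φ (Complex.I * (Real.sqrt d : ℂ)) = 39)
    (h44 : eigenMultiplicity A φ (-(Complex.I * (Real.sqrt d : ℂ))) = 44) (N : ℕ) :
    IsDivisorGenerated (A.powSucc N) := by
  refine AbelianVariety.isDivisorGenerated_powSucc_of_ribetType_ofCoreSmul A φ hd hφ hE2 (by omega) (by omega) ?_ N
  intro W' _ _ _ 𝔊 ι P' Q' s hbr hirr hι hιι hP' hQ' hfinP' hfinQ' hadd hsmul hsymm hPQ hdefP hdefQ hadj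
  exact UnitaryThirtyNineFortyFour.eq_top_of_smul hbr hirr hι hιι hP' hQ' (by rw [hfinP', h39]) (by rw [hfinQ', h44]) hadd
    hsmul hsymm hPQ hdefP hdefQ hadj

/-- The mirror: `n_{i√d}(φ) = 44`, `n_{−i√d}(φ) = 39` (core `UnitaryThirtyNineFortyFour.eq_top_of_smul'`).
[cite: Ribet1983, Thm. 0 and Thm. 3] [cite: Gordon1997, Thm. 6.3 (3) and Corollary] -/
theorem AbelianVariety.isDivisorGenerated_powSucc_of_ribetTypeThirtyNineFortyFour' (A : AbelianVariety ℂ) (φ : A ⟶ A)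
    {d : ℕ} (hd : 0 < d) (hφ : φ ≫ φ = -(d • 𝟙 A)) (hE2 : Module.finrank ℚ A.endAlgebra = 2)
    (h44 : eigenMultiplicity A φ (Complex.I * (Real.sqrt d : ℂ)) = 44)
    (h39 : eigenMultiplicity A φ (-(Complex.I * (Real.sqrt d : ℂ))) = 39) (N : ℕ) :
    IsDivisorGenerated (A.powSucc N) := by
  refine AbelianVariety.isDivisorGenerated_powSucc_of_ribetType_ofCoreSmul A φ hd hφ hE2 (by omega) (by omega) ?_ N
  intro W' _ _ _ 𝔊 ι P' Q' s hbr hirr hι hιι hP' hQ' hfinP' hfinQ' hadd hsmul hsymm hPQ hdefP hdefQ hadj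
  exact UnitaryThirtyNineFortyFour.eq_top_of_smul' hbr hirr hι hιι hP' hQ' (by rw [hfinP', h44]) (by rw [hfinQ', h39])
    hadd hsmul hsymm hPQ hdefP hdefQ hadj

/-- **The Hodge conjecture for all powers `A^{N+1}` of an abelian variety of Ribet type `(39, 44)` — UNCONDITIONAL.**
[cite: Ribet1983, Thm. 3] [cite: Deligne2000, §1] -/
theorem hodgeConjectureFor_powSucc_of_ribetTypeThirtyNineFortyFour (A : AbelianVariety ℂ) (φ : A ⟶ A)
    {d : ℕ} (hd : 0 < d) (hφ : φ ≫ φ = -(d • 𝟙 A)) (hE2 : Module.finrank ℚ A.endAlgebra = 2)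
    (h39 : eigenMultiplicity A φ (Complex.I * (Real.sqrt d : ℂ)) = 39)
    (h44 : eigenMultiplicity A φ (-(Complex.I * (Real.sqrt d : ℂ))) = 44) (N : ℕ) :
    HodgeConjectureFor (A.powSucc N).dim (A.powSucc N).X :=
  hodgeConjectureFor_of_isDivisorGenerated _
    (AbelianVariety.isDivisorGenerated_powSucc_of_ribetTypeThirtyNineFortyFour A φ hd hφ hE2 h39 h44 N)

/-- **83-FOLDS of signature `{39, 44}`: `B• = D•` on all powers — UNCONDITIONAL** (either eigenvalue may carry the `39`).
[cite: Ribet1983, Thm. 0 and Thm. 3] [cite: MoonenZarhin1999LowDim, §2 (2.4)] -/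
theorem AbelianVariety.isDivisorGenerated_powSucc_of_eightythreefold_thirtyNineFortyFour (A : AbelianVariety ℂ)
    (φ : A ⟶ A) {d : ℕ} (hd : 0 < d) (hφ : φ ≫ φ = -(d • 𝟙 A)) (hE2 : Module.finrank ℚ A.endAlgebra = 2)
    (hX : A.dim = 83)
    (h39 : eigenMultiplicity A φ (Complex.I * (Real.sqrt d : ℂ)) = 39 ∨
      eigenMultiplicity A φ (-(Complex.I * (Real.sqrt d : ℂ))) = 39)
    (N : ℕ) : IsDivisorGenerated (A.powSucc N) := by
  have hsum := eigenMultiplicity_add_eigenMultiplicity_neg_eq_dim A φ hd hφ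
  rw [hX] at hsum
  rcases h39 with h | h
  · exact AbelianVariety.isDivisorGenerated_powSucc_of_ribetTypeThirtyNineFortyFour A φ hd hφ hE2 h (by omega) N
  · exact AbelianVariety.isDivisorGenerated_powSucc_of_ribetTypeThirtyNineFortyFour' A φ hd hφ hE2 (by omega) h N

/-- **The Hodge conjecture for all powers of a 83-FOLD of signature `{39, 44}` — UNCONDITIONAL.**
[cite: Ribet1983, Thm. 3] [cite: Deligne2000, §1] -/
theorem hodgeConjectureFor_powSucc_of_eightythreefold_thirtyNineFortyFour (A : AbelianVariety ℂ)
    (φ : A ⟶ A) {d : ℕ} (hd : 0 < d) (hφ : φ ≫ φ = -(d • 𝟙 A)) (hE2 : Module.finrank ℚ A.endAlgebra = 2)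
    (hX : A.dim = 83)
    (h39 : eigenMultiplicity A φ (Complex.I * (Real.sqrt d : ℂ)) = 39 ∨
      eigenMultiplicity A φ (-(Complex.I * (Real.sqrt d : ℂ))) = 39)
    (N : ℕ) : HodgeConjectureFor (A.powSucc N).dim (A.powSucc N).X :=
  hodgeConjectureFor_of_isDivisorGenerated _
    (AbelianVariety.isDivisorGenerated_powSucc_of_eightythreefold_thirtyNineFortyFour A φ hd hφ hE2 hX h39 N)

/-- **Ribet 1983 Thm. 3 at `(n′, n″) = (41, 42)` — UNCONDITIONAL** (core `UnitaryFortyOneFortyTwo.eq_top_of_smul`).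
[cite: Ribet1983, Thm. 0 and Thm. 3] [cite: Gordon1997, Thm. 6.3 (3) and Corollary] -/
theorem AbelianVariety.isDivisorGenerated_powSucc_of_ribetTypeFortyOneFortyTwo (A : AbelianVariety ℂ) (φ : A ⟶ A)
    {d : ℕ} (hd : 0 < d) (hφ : φ ≫ φ = -(d • 𝟙 A)) (hE2 : Module.finrank ℚ A.endAlgebra = 2)
    (h41 : eigenMultiplicity A φ (Complex.I * (Real.sqrt d : ℂ)) = 41)
    (h42 : eigenMultiplicity A φ (-(Complex.I * (Real.sqrt d : ℂ))) = 42) (N : ℕ) :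
    IsDivisorGenerated (A.powSucc N) := by
  refine AbelianVariety.isDivisorGenerated_powSucc_of_ribetType_ofCoreSmul A φ hd hφ hE2 (by omega) (by omega) ?_ N
  intro W' _ _ _ 𝔊 ι P' Q' s hbr hirr hι hιι hP' hQ' hfinP' hfinQ' hadd hsmul hsymm hPQ hdefP hdefQ hadj
  exact UnitaryFortyOneFortyTwo.eq_top_of_smul hbr hirr hι hιι hP' hQ' (by rw [hfinP', h41]) (by rw [hfinQ', h42]) hadd
    hsmul hsymm hPQ hdefP hdefQ hadj

/-- The mirror: `n_{i√d}(φ) = 42`, `n_{−i√d}(φ) = 41` (core `UnitaryFortyOneFortyTwo.eq_top_of_smul'`).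
[cite: Ribet1983, Thm. 0 and Thm. 3] [cite: Gordon1997, Thm. 6.3 (3) and Corollary] -/
theorem AbelianVariety.isDivisorGenerated_powSucc_of_ribetTypeFortyOneFortyTwo' (A : AbelianVariety ℂ) (φ : A ⟶ A)
    {d : ℕ} (hd : 0 < d) (hφ : φ ≫ φ = -(d • 𝟙 A)) (hE2 : Module.finrank ℚ A.endAlgebra = 2)
    (h42 : eigenMultiplicity A φ (Complex.I * (Real.sqrt d : ℂ)) = 42)
    (h41 : eigenMultiplicity A φ (-(Complex.I * (Real.sqrt d : ℂ))) = 41) (N : ℕ) :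
    IsDivisorGenerated (A.powSucc N) := by
  refine AbelianVariety.isDivisorGenerated_powSucc_of_ribetType_ofCoreSmul A φ hd hφ hE2 (by omega) (by omega) ?_ N
  intro W' _ _ _ 𝔊 ι P' Q' s hbr hirr hι hιι hP' hQ' hfinP' hfinQ' hadd hsmul hsymm hPQ hdefP hdefQ hadj
  exact UnitaryFortyOneFortyTwo.eq_top_of_smul' hbr hirr hι hιι hP' hQ' (by rw [hfinP', h42]) (by rw [hfinQ', h41])
    hadd hsmul hsymm hPQ hdefP hdefQ hadj

/-- **The Hodge conjecture for all powers `A^{N+1}` of an abelian variety of Ribet type `(41, 42)` — UNCONDITIONAL.**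
[cite: Ribet1983, Thm. 3] [cite: Deligne2000, §1] -/
theorem hodgeConjectureFor_powSucc_of_ribetTypeFortyOneFortyTwo (A : AbelianVariety ℂ) (φ : A ⟶ A)
    {d : ℕ} (hd : 0 < d) (hφ : φ ≫ φ = -(d • 𝟙 A)) (hE2 : Module.finrank ℚ A.endAlgebra = 2)
    (h41 : eigenMultiplicity A φ (Complex.I * (Real.sqrt d : ℂ)) = 41)
    (h42 : eigenMultiplicity A φ (-(Complex.I * (Real.sqrt d : ℂ))) = 42) (N : ℕ) :
    HodgeConjectureFor (A.powSucc N).dim (A.powSucc N).X :=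
  hodgeConjectureFor_of_isDivisorGenerated _
    (AbelianVariety.isDivisorGenerated_powSucc_of_ribetTypeFortyOneFortyTwo A φ hd hφ hE2 h41 h42 N)

/-- **83-FOLDS of signature `{41, 42}`: `B• = D•` on all powers — UNCONDITIONAL** (either eigenvalue may carry the `41`).
[cite: Ribet1983, Thm. 0 and Thm. 3] [cite: MoonenZarhin1999LowDim, §2 (2.4)] -/
theorem AbelianVariety.isDivisorGenerated_powSucc_of_eightythreefold_fortyOneFortyTwo (A : AbelianVariety ℂ)
    (φ : A ⟶ A) {d : ℕ} (hd : 0 < d) (hφ : φ ≫ φ = -(d • 𝟙 A)) (hE2 : Module.finrank ℚ A.endAlgebra = 2)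
    (hX : A.dim = 83)
    (h41 : eigenMultiplicity A φ (Complex.I * (Real.sqrt d : ℂ)) = 41 ∨
      eigenMultiplicity A φ (-(Complex.I * (Real.sqrt d : ℂ))) = 41)
    (N : ℕ) : IsDivisorGenerated (A.powSucc N) := by
  have hsum := eigenMultiplicity_add_eigenMultiplicity_neg_eq_dim A φ hd hφ
  rw [hX] at hsum
  rcases h41 with h | h
  · exact AbelianVariety.isDivisorGenerated_powSucc_of_ribetTypeFortyOneFortyTwo A φ hd hφ hE2 h (by omega) N
  · exact AbelianVariety.isDivisorGenerated_powSucc_of_ribetTypeFortyOneFortyTwo' A φ hd hφ hE2 (by omega) h N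

/-- **The Hodge conjecture for all powers of a 83-FOLD of signature `{41, 42}` — UNCONDITIONAL.**
[cite: Ribet1983, Thm. 3] [cite: Deligne2000, §1] -/
theorem hodgeConjectureFor_powSucc_of_eightythreefold_fortyOneFortyTwo (A : AbelianVariety ℂ)
    (φ : A ⟶ A) {d : ℕ} (hd : 0 < d) (hφ : φ ≫ φ = -(d • 𝟙 A)) (hE2 : Module.finrank ℚ A.endAlgebra = 2)
    (hX : A.dim = 83)
    (h41 : eigenMultiplicity A φ (Complex.I * (Real.sqrt d : ℂ)) = 41 ∨
      eigenMultiplicity A φ (-(Complex.I * (Real.sqrt d : ℂ))) = 41)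
    (N : ℕ) : HodgeConjectureFor (A.powSucc N).dim (A.powSucc N).X :=
  hodgeConjectureFor_of_isDivisorGenerated _
    (AbelianVariety.isDivisorGenerated_powSucc_of_eightythreefold_fortyOneFortyTwo A φ hd hφ hE2 hX h41 N)

end Cells

/-! ### §2 Every simple complex abelian 83-fold with `End⁰ ≠ ℚ` -/

section Final

variable {X : AbelianVariety ℂ}

/-- **`B• = D•` on all powers of a SIMPLE complex abelian `83`-FOLD, granted ONLY the shape `End⁰ = ℚ`.** (The census
`isDivisorGenerated_powSucc_of_isSimple_eightythreefold` with all its imaginary-quadratic inputs, the `k`-signatures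
`{8, 75}`, `{9, 74}`, `{14, 69}`, `{15, 68}`, `{17, 66}`, `{18, 65}`, `{19, 64}`, `{20, 63}`, `{21, 62}`, `{23, 60}`, `{25, 58}`, `{26, 57}`, `{27, 56}`, `{28, 55}`, `{29, 54}`, `{31, 52}`, `{32, 51}`, `{33, 50}`, `{34, 49}`, `{35, 48}`, `{37, 46}`, `{38, 45}`, `{39, 44}`, `{41, 42}`, supplied by §1.)
[cite: MoonenZarhin1999LowDim, §2 (2.4) and Thm. (2.7)] [cite: Ribet1983, Thms. 0–3] [cite: Gordon1997, Thm. 6.3 and Corollary] -/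
theorem isDivisorGenerated_powSucc_of_isSimple_eightythreefold' (hs : X.IsSimple) (hX : X.dim = 83)
    (h1 : Module.finrank ℚ X.endAlgebra = 1 → ∀ N : ℕ, IsDivisorGenerated (X.powSucc N)) (N : ℕ) :
    IsDivisorGenerated (X.powSucc N) := by
  refine isDivisorGenerated_powSucc_of_isSimple_eightythreefold hs hX h1 (fun φ d hd hφ he2 h N => ?_) N
  have hsum := eigenMultiplicity_add_eigenMultiplicity_neg_eq_dim X φ hd hφ
  rw [hX] at hsum
  by_cases h8 : eigenMultiplicity X φ (Complex.I * (Real.sqrt d : ℂ)) = 8 ∨ eigenMultiplicity X φ (-(Complex.I * (Real.sqrt d : ℂ))) = 8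
  · exact AbelianVariety.isDivisorGenerated_powSucc_of_eightythreefold_eightSeventyFive X φ hd hφ he2 hX h8 N
  by_cases h9 : eigenMultiplicity X φ (Complex.I * (Real.sqrt d : ℂ)) = 9 ∨ eigenMultiplicity X φ (-(Complex.I * (Real.sqrt d : ℂ))) = 9
  · exact AbelianVariety.isDivisorGenerated_powSucc_of_eightythreefold_nineSeventyFour X φ hd hφ he2 hX h9 N
  by_cases h14 : eigenMultiplicity X φ (Complex.I * (Real.sqrt d : ℂ)) = 14 ∨ eigenMultiplicity X φ (-(Complex.I * (Real.sqrt d : ℂ))) = 14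
  · exact AbelianVariety.isDivisorGenerated_powSucc_of_eightythreefold_fourteenSixtyNine X φ hd hφ he2 hX h14 N
  by_cases h15 : eigenMultiplicity X φ (Complex.I * (Real.sqrt d : ℂ)) = 15 ∨ eigenMultiplicity X φ (-(Complex.I * (Real.sqrt d : ℂ))) = 15
  · exact AbelianVariety.isDivisorGenerated_powSucc_of_eightythreefold_fifteenSixtyEight X φ hd hφ he2 hX h15 N
  by_cases h17 : eigenMultiplicity X φ (Complex.I * (Real.sqrt d : ℂ)) = 17 ∨ eigenMultiplicity X φ (-(Complex.I * (Real.sqrt d : ℂ))) = 17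
  · exact AbelianVariety.isDivisorGenerated_powSucc_of_eightythreefold_seventeenSixtySix X φ hd hφ he2 hX h17 N
  by_cases h18 : eigenMultiplicity X φ (Complex.I * (Real.sqrt d : ℂ)) = 18 ∨ eigenMultiplicity X φ (-(Complex.I * (Real.sqrt d : ℂ))) = 18
  · exact AbelianVariety.isDivisorGenerated_powSucc_of_eightythreefold_eighteenSixtyFive X φ hd hφ he2 hX h18 N
  by_cases h19 : eigenMultiplicity X φ (Complex.I * (Real.sqrt d : ℂ)) = 19 ∨ eigenMultiplicity X φ (-(Complex.I * (Real.sqrt d : ℂ))) = 19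
  · exact AbelianVariety.isDivisorGenerated_powSucc_of_eightythreefold_nineteenSixtyFour X φ hd hφ he2 hX h19 N
  by_cases h20 : eigenMultiplicity X φ (Complex.I * (Real.sqrt d : ℂ)) = 20 ∨ eigenMultiplicity X φ (-(Complex.I * (Real.sqrt d : ℂ))) = 20
  · exact AbelianVariety.isDivisorGenerated_powSucc_of_eightythreefold_twentySixtyThree X φ hd hφ he2 hX h20 N
  by_cases h21 : eigenMultiplicity X φ (Complex.I * (Real.sqrt d : ℂ)) = 21 ∨ eigenMultiplicity X φ (-(Complex.I * (Real.sqrt d : ℂ))) = 21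
  · exact AbelianVariety.isDivisorGenerated_powSucc_of_eightythreefold_twentyOneSixtyTwo X φ hd hφ he2 hX h21 N
  by_cases h23 : eigenMultiplicity X φ (Complex.I * (Real.sqrt d : ℂ)) = 23 ∨ eigenMultiplicity X φ (-(Complex.I * (Real.sqrt d : ℂ))) = 23
  · exact AbelianVariety.isDivisorGenerated_powSucc_of_eightythreefold_twentyThreeSixty X φ hd hφ he2 hX h23 N
  by_cases h25 : eigenMultiplicity X φ (Complex.I * (Real.sqrt d : ℂ)) = 25 ∨ eigenMultiplicity X φ (-(Complex.I * (Real.sqrt d : ℂ))) = 25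
  · exact AbelianVariety.isDivisorGenerated_powSucc_of_eightythreefold_twentyFiveFiftyEight X φ hd hφ he2 hX h25 N
  by_cases h26 : eigenMultiplicity X φ (Complex.I * (Real.sqrt d : ℂ)) = 26 ∨ eigenMultiplicity X φ (-(Complex.I * (Real.sqrt d : ℂ))) = 26
  · exact AbelianVariety.isDivisorGenerated_powSucc_of_eightythreefold_twentySixFiftySeven X φ hd hφ he2 hX h26 N
  by_cases h27 : eigenMultiplicity X φ (Complex.I * (Real.sqrt d : ℂ)) = 27 ∨ eigenMultiplicity X φ (-(Complex.I * (Real.sqrt d : ℂ))) = 27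
  · exact AbelianVariety.isDivisorGenerated_powSucc_of_eightythreefold_twentySevenFiftySix X φ hd hφ he2 hX h27 N
  by_cases h28 : eigenMultiplicity X φ (Complex.I * (Real.sqrt d : ℂ)) = 28 ∨ eigenMultiplicity X φ (-(Complex.I * (Real.sqrt d : ℂ))) = 28
  · exact AbelianVariety.isDivisorGenerated_powSucc_of_eightythreefold_twentyEightFiftyFive X φ hd hφ he2 hX h28 N
  by_cases h29 : eigenMultiplicity X φ (Complex.I * (Real.sqrt d : ℂ)) = 29 ∨ eigenMultiplicity X φ (-(Complex.I * (Real.sqrt d : ℂ))) = 29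
  · exact AbelianVariety.isDivisorGenerated_powSucc_of_eightythreefold_twentyNineFiftyFour X φ hd hφ he2 hX h29 N
  by_cases h31 : eigenMultiplicity X φ (Complex.I * (Real.sqrt d : ℂ)) = 31 ∨ eigenMultiplicity X φ (-(Complex.I * (Real.sqrt d : ℂ))) = 31
  · exact AbelianVariety.isDivisorGenerated_powSucc_of_eightythreefold_thirtyOneFiftyTwo X φ hd hφ he2 hX h31 N
  by_cases h32 : eigenMultiplicity X φ (Complex.I * (Real.sqrt d : ℂ)) = 32 ∨ eigenMultiplicity X φ (-(Complex.I * (Real.sqrt d : ℂ))) = 32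
  · exact AbelianVariety.isDivisorGenerated_powSucc_of_eightythreefold_thirtyTwoFiftyOne X φ hd hφ he2 hX h32 N
  by_cases h33 : eigenMultiplicity X φ (Complex.I * (Real.sqrt d : ℂ)) = 33 ∨ eigenMultiplicity X φ (-(Complex.I * (Real.sqrt d : ℂ))) = 33
  · exact AbelianVariety.isDivisorGenerated_powSucc_of_eightythreefold_thirtyThreeFifty X φ hd hφ he2 hX h33 N
  by_cases h34 : eigenMultiplicity X φ (Complex.I * (Real.sqrt d : ℂ)) = 34 ∨ eigenMultiplicity X φ (-(Complex.I * (Real.sqrt d : ℂ))) = 34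
  · exact AbelianVariety.isDivisorGenerated_powSucc_of_eightythreefold_thirtyFourFortyNine X φ hd hφ he2 hX h34 N
  by_cases h35 : eigenMultiplicity X φ (Complex.I * (Real.sqrt d : ℂ)) = 35 ∨ eigenMultiplicity X φ (-(Complex.I * (Real.sqrt d : ℂ))) = 35
  · exact AbelianVariety.isDivisorGenerated_powSucc_of_eightythreefold_thirtyFiveFortyEight X φ hd hφ he2 hX h35 N
  by_cases h37 : eigenMultiplicity X φ (Complex.I * (Real.sqrt d : ℂ)) = 37 ∨ eigenMultiplicity X φ (-(Complex.I * (Real.sqrt d : ℂ))) = 37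
  · exact AbelianVariety.isDivisorGenerated_powSucc_of_eightythreefold_thirtySevenFortySix X φ hd hφ he2 hX h37 N
  by_cases h38 : eigenMultiplicity X φ (Complex.I * (Real.sqrt d : ℂ)) = 38 ∨ eigenMultiplicity X φ (-(Complex.I * (Real.sqrt d : ℂ))) = 38
  · exact AbelianVariety.isDivisorGenerated_powSucc_of_eightythreefold_thirtyEightFortyFive X φ hd hφ he2 hX h38 N
  by_cases h39 : eigenMultiplicity X φ (Complex.I * (Real.sqrt d : ℂ)) = 39 ∨ eigenMultiplicity X φ (-(Complex.I * (Real.sqrt d : ℂ))) = 39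
  · exact AbelianVariety.isDivisorGenerated_powSucc_of_eightythreefold_thirtyNineFortyFour X φ hd hφ he2 hX h39 N
  by_cases h41 : eigenMultiplicity X φ (Complex.I * (Real.sqrt d : ℂ)) = 41 ∨ eigenMultiplicity X φ (-(Complex.I * (Real.sqrt d : ℂ))) = 41
  · exact AbelianVariety.isDivisorGenerated_powSucc_of_eightythreefold_fortyOneFortyTwo X φ hd hφ he2 hX h41 N
  omega

/-- **`B• = D•` on all powers of EVERY SIMPLE complex abelian `83`-FOLD with `End⁰ ≠ ℚ` — UNCONDITIONAL.**
[cite: MoonenZarhin1999LowDim, §2 (2.4) and Thm. (2.7)] [cite: Ribet1983, Thms. 0–3] -/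
theorem isDivisorGenerated_powSucc_of_isSimple_eightythreefold_of_finrank_endAlgebra_ne_one (hs : X.IsSimple)
    (hX : X.dim = 83) (hne : Module.finrank ℚ X.endAlgebra ≠ 1) (N : ℕ) : IsDivisorGenerated (X.powSucc N) :=
  isDivisorGenerated_powSucc_of_isSimple_eightythreefold' hs hX (fun h => absurd h hne) N

/-- **The Hodge conjecture for all powers of EVERY SIMPLE complex abelian `83`-FOLD with `End⁰ ≠ ℚ` —
UNCONDITIONAL.** [cite: MoonenZarhin1999LowDim, §2 Thm. (2.7)] [cite: Ribet1983, Thm. 3] [cite: Deligne2000, §1] -/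
theorem hodgeConjectureFor_powSucc_of_isSimple_eightythreefold_of_finrank_endAlgebra_ne_one (hs : X.IsSimple)
    (hX : X.dim = 83) (hne : Module.finrank ℚ X.endAlgebra ≠ 1) (N : ℕ) :
    HodgeConjectureFor (X.powSucc N).dim (X.powSucc N).X :=
  hodgeConjectureFor_of_isDivisorGenerated _
    (isDivisorGenerated_powSucc_of_isSimple_eightythreefold_of_finrank_endAlgebra_ne_one hs hX hne N)

end Final

end Literature.AlgebraicGeometry.HodgeTheory

end

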